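import Literature.NumberTheory.Sieve.BombieriAsymptoticSieveSigma0
import Literature.NumberTheory.Sieve.BombieriAsymptoticSieveProofs
import HarnessLib

/-!
# Bombieri's asymptotic sieve at a finite level (`Bombieri1976_asymptotic_sieve_finiteLevel`)

Topic `Literature/NumberTheory/Sieve`, companion ("Proofs") file of `BombieriAsymptoticSieve.lean`.
Source: J. Friedlander, H. Iwaniec, *On Bombieri's asymptotic sieve*, Ann. Scuola Norm. Sup. Pisa
Cl. Sci. (4) **5** (1978) 719–756 [FriedlanderIwaniecPisa1978], §4 "A Theorem of Bombieri", Lemmata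
10, 11, 12 (p. 738) and the conclusion of the proof of Theorem 1 (pp. 739–740); E. Bombieri, *The
asymptotic sieve*, RIMS Kôkyûroku **294** (1977) 1–8 [BombieriRIMS1977] for the hypotheses (A₁)–(A₅)
(`SieveSequence.BombieriA1`, …, `SieveSequence.BombieriA5` of `BombieriAsymptoticSieve.lean`).

Main result: `Bombieri1976_asymptotic_sieve_finiteLevel_holds`, the discharge of the named fact
`Bombieri1976_asymptotic_sieve_finiteLevel` of `BombieriAsymptoticSieve.lean`: for a sequence with
Bombieri's normalisation `A(x) = ∑_{n ≤ x} a_n` satisfying (A₁), (A₃), (A₄), (A₅), with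
`H = ∏_p (1 − 1/f(p))(1 − 1/p)⁻¹`, for every `k ≥ 2` and every `ε' > 0` there is `θ₀ < 1` such that
the level-`x^{θ₀}` hypothesis (A₂) (`SieveSequence.BombieriA2At A θ₀`) alone gives
`|∑_{n ≤ x} a_n Λ_k(n) − k H A(x)(log x)^{k−1}| ≤ ε' k H A(x)(log x)^{k−1}` for all large `x`. This
is what the printed proof of [FriedlanderIwaniecPisa1978] Theorem 1 shows (pp. 739–740): with
`y = x^{1−2ε}`, `z = x^{ε^{4/3}}`, `s = ε^{−1/3}`, Lemmata 10, 11, 12 and Lemma 3 give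
`∑_{n ≤ x} a_n Λ_{(k)}(n) = γ_{(k)} H A(x)(log x)^{|k|−1}(1 + O(ε^{1/3}))` for `x > x₀(ε, (k))`, and
the remainders `R(x, d)` enter only through (A₂) summed over moduli `d < x^{1−ε}` (Lemma 11:
`νd ≤ z² x/y`; Lemma 12: `νd < z^s y ≤ x^{1−ε}`) and, in the `Σ₀`-bound (Lemma 10, here the tree's
proof `BombieriSieve.SigmaZero.sigma0_bound_of_density_nonneg` along Friedlander–Iwaniec's remark
"this proof can also be simplified by means of the fundamental lemma"), over moduli
`d < x^{1−1/(5k)}`.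

## How the tree's `θ₀ = 1` proof is re-assembled at a finite level

The tree proves Theorem 1 at `θ₀ = 1` (`Bombieri1976_asymptotic_sieve_holds`,
`BombieriAsymptoticSieveTheorem1.lean`) from `BombieriSieve.core` and the proved lemma-facts
`FI1978_lemma10_holds` (`BombieriAsymptoticSieveSigma0.lean`), `FI1978_lemma11_holds`,
`FI1978_lemma12_holds` (`BombieriAsymptoticSieveProofs.lean`), all of which consume the bundle
`SieveSequence.IsBombieriSequence` and hence the full (A₂). Inspection of those proofs shows that
(A₂) is invoked exactly once in each of Lemmata 10, 11, 12 (at the levels just listed), once in the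
dichotomy `BombieriSieve.density_nonneg_or_size_eq_zero` (`g ≥ 0` or `A ≡ 0`; level `x^{1/2}`), and
nowhere in Lemmata 6–9 (`BombieriAsymptoticSieveLemmata.lean`), which concern the density alone but
are stated for the bundle. Accordingly this file contains:

* `BombieriSieve.isBombieriSequence_nullWithDensity` — the null sequence `a_n = 0`, `A(x) = 0`
  carrying the density of `𝒜` satisfies (A₁)–(A₅) as soon as `𝒜` satisfies (A₁), (A₅) (its
  remainders vanish); through it the density-only results are available without (A₂):
  `BombieriSieve.FI1978_lemma7_of_A1_A5` (Lemma 7), `BombieriSieve.hasSieveDimension_of_A1_A5`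
  (dimension `κ = 1`), `BombieriSieve.FI1978_lemma9_of_A1_A5` (Lemma 9) — one-line specialisations
  of the tree's `FI1978_lemma7_rat`, `hasSieveDimension`, `FI1978_lemma9_rat`, no proof being
  repeated;
* `BombieriSieve.density_nonneg_or_size_eq_zero_of_bombieriA2At` — the dichotomy from (A₂) at any
  level `x^{θ₀}`, `θ₀ > 0`;
* `BombieriSieve.FI1978_lemma11_finiteLevel`, `BombieriSieve.FI1978_lemma12_finiteLevel`,
  `BombieriSieve.SigmaZero.sigma0_bound_finiteLevel` (with
  `BombieriSieve.SigmaZero.remainder_pointwise_of_bombieriA3`) — Lemmata 11, 12, 10 for a sequence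
  with `g ≥ 0` satisfying (A₁), (A₅) (resp. (A₁), (A₃), (A₄), (A₅)), in which the single use of (A₂)
  is replaced by its output at the relevant `x`, an explicit hypothesis
  `∑_{d < x^{λ}} |R(y_d, d)| ≤ C₂ A(x)(log x)^{−B}` (`λ = 1 − ε`, `B = 3`, resp. `λ = 1 − ε`,
  `B = k + 1`, resp. `λ = 1 − 1/(5k)`, `B = 2k + 1`), the threshold `x₀` being allowed to depend on
  `C₂`. The proofs are those of `BombieriSieve.FI1978_lemma11_of_fundamentalLemma`
  (`BombieriAsymptoticSieveLemma11.lean`), `BombieriSieve.FI1978_lemma12_of_fundamentalLemma`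
  (`BombieriAsymptoticSieveLemma12.lean`) and
  `BombieriSieve.SigmaZero.sigma0_bound_of_density_nonneg` (`BombieriAsymptoticSieveSigma0.lean`)
  verbatim up to this change of interface (the fundamental lemma being the theorem
  `SieveSequence.fundamental_lemma_uniform_holds`); they are repeated here because the tree's
  versions fix the interface `IsBombieriSequence → …` in their statements;
* `BombieriSieve.core_finiteLevel` — pp. 739–740 up to
  `S_k(x) = H A(x) F + O(ε^{1/3} A(x)(log x)^{k−1})`: for all large `u = ε^{−1/3}` (also `u ≥ 5k`),
  EVERY `θ₀ > 1 − u^{−3}` works: (A₂) at level `x^{θ₀}` supplies the three inputs at the levels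
  `x^{1−u^{−3}}` (Lemmata 11, 12 with `ε = u^{−3}`) and `x^{1−1/(5k)} ≤ x^{1−u^{−3}}`, and the
  arithmetic is that of `BombieriSieve.core` (`sigma0_arith`, `sigma1_arith`, `sigma2_arith`,
  `params`);
* `Bombieri1976_asymptotic_sieve_finiteLevel_holds` — p. 740: comparison with `a_n ≡ 1` (the tree's
  `BombieriSieve.core` for `SieveSequence.integers` at the same `u`, with the same `F`), Lemma 3
  (`FI1978_lemma3_rat_holds`), `H > 0` (Lemma 7) and `BombieriSieve.comparison_arith`; the level
  exponent offered is `θ₀ = 1 − u^{−3}/2` with `u = u(ε', 𝒜, H, k)`. If `g(d) < 0` for some `d ≥ 1`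
  (Bombieri's (A₁) does not exclude it), `θ₀ = 1/2` is offered: (A₂) at that level forces `A ≡ 0`
  and both sides vanish.

No new definitions and no new named facts: every declaration below is a theorem.
-/

noncomputable section

open Filter Asymptotics Finset
open scoped Topology ArithmeticFunction.Moebius

namespace Literature.NumberTheory.Sieve

namespace BombieriSieve

/-! ### Density-only consequences of (A₁), (A₅), via the null sequence -/

/-- **The null sequence with the density of `𝒜` is a Bombieri sequence.** If `𝒜` satisfies (A₁) and
(A₅) (conditions on the density `g = 1/f` alone), then the sequence `a_n = 0`, `A(x) = 0` with the
same density satisfies all of (A₁)–(A₅) (`SieveSequence.IsBombieriSequence`): its counting function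
and all its remainders `R(x; d) = 0 − g(d)·0` vanish, so the normalisation `A(x) = ∑_{n ≤ x} a_n`,
(A₂), (A₃) (with `F ≡ 1`, `c₁ = c₂ = 1`, using `∑_{d < x} 1/d ≤ 3 log x`,
`BombieriSieve.sum_Ico_inv_le_log`) and (A₄) hold trivially. A transport device: results of
`BombieriAsymptoticSieveLemmata.lean` stated for Bombieri sequences but concerning the density only
(Lemmata 7, 9, the sieve dimension) thereby hold under (A₁), (A₅) alone. [folklore] -/
theorem isBombieriSequence_nullWithDensity (A : SieveSequence) (h1 : A.BombieriA1)
    (h5 : A.BombieriA5) :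
    SieveSequence.IsBombieriSequence
      { a := fun _ => 0, a_nonneg := fun _ => le_rfl, size := fun _ => 0,
        density := A.density, density_mult := A.density_mult } := by
  set Z : SieveSequence :=
    { a := fun _ => 0, a_nonneg := fun _ => le_rfl, size := fun _ => 0,
      density := A.density, density_mult := A.density_mult }
  have hcs : ∀ d x, Z.congrSum d x = 0 := fun d x => Finset.sum_eq_zero fun _ _ => rfl
  have hrem : ∀ d x, Z.remainder d x = 0 := fun d x => by
    rw [SieveSequence.remainder, hcs]
    show (0 : ℝ) - A.density d * 0 = 0
    ring
  refine ⟨fun x => (hcs 1 x).symm, h1, ?_, ?_, ?_, h5⟩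
  · intro ε _ B _
    refine ⟨0, Filter.Eventually.of_forall fun x y _ => ?_⟩
    rw [Finset.sum_eq_zero fun d _ => by rw [hrem, abs_zero]]
    show (0 : ℝ) ≤ 0 * 0 / Real.log x ^ B
    simp
  · refine ⟨fun _ => 1, 1, 1, one_pos, one_pos, ?_, ?_, ⟨0, ?_⟩⟩
    · intro ε hε
      exact ⟨1, fun d hd => by
        rw [abs_one, one_mul]
        exact Real.one_le_rpow (by exact_mod_cast hd) hε.le⟩
    · refine IsBigO.of_bound 3 ?_
      filter_upwards [eventually_ge_atTop (3 : ℝ)] with x hx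
      have hlog : 0 ≤ Real.log x := Real.log_nonneg (by linarith)
      have hsum : ∑ d ∈ Ico 1 ⌈x⌉₊, (1 : ℝ) ^ 2 / d = ∑ d ∈ Ico 1 ⌈x⌉₊, (d : ℝ)⁻¹ :=
        Finset.sum_congr rfl fun d _ => by rw [one_pow, one_div]
      rw [Real.norm_of_nonneg (Finset.sum_nonneg fun d _ => by positivity), Real.rpow_one,
        Real.norm_of_nonneg hlog, hsum]
      exact sum_Ico_inv_le_log hx
    · refine Filter.Eventually.of_forall fun x d _ _ => ?_
      rw [hrem, abs_zero]
      show (0 : ℝ) ≤ 0 * ((1 : ℝ) / d) * 0 * Real.log x ^ (1 : ℝ)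
      simp
  · constructor
    · have h0 : (fun x : ℝ => ∫ t in (1 : ℝ)..x, Z.size t / t) = fun _ => 0 := by
        funext x
        show (∫ t in (1 : ℝ)..x, (0 : ℝ) / t) = 0
        simp
      rw [h0]
      exact isLittleO_zero _ _
    · show (fun _ : ℝ => (0 : ℝ)) =o[atTop] fun x : ℝ => (0 : ℝ) / Real.log x
      exact isLittleO_zero _ _

/-- **[FriedlanderIwaniecPisa1978] Lemma 7 (`K = ℚ`, `N = 1`) under (A₁), (A₅) alone**: there are
`H > 0` with `A.HasDensityConstant H`, `η > 0` and `C` with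
`|V(z) − H ∏_{p<z}(1 − 1/p)| ≤ C z^{−η} H ∏_{p<z}(1 − 1/p)` and `V(z) ≤ C/log z` for all `z ≥ 2`
(`V(z) = ∏_{p<z}(1 − g(p))`). The tree's `BombieriSieve.FI1978_lemma7_rat` applied to the null
sequence with the density of `𝒜` (`isBombieriSequence_nullWithDensity`), whose `V`, `H` are those of
`𝒜`. [cite: FriedlanderIwaniecPisa1978, Lemma 7 (K = Q, N = 1)] -/
theorem FI1978_lemma7_of_A1_A5 (A : SieveSequence) (h1 : A.BombieriA1) (h5 : A.BombieriA5) :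
    ∃ H : ℝ, 0 < H ∧ A.HasDensityConstant H ∧ ∃ η : ℝ, 0 < η ∧ ∃ C : ℝ, ∀ z : ℝ, 2 ≤ z →
      |A.densityProduct (primesProdBelow z) - H * ∏ p ∈ Nat.primesBelow ⌈z⌉₊, (1 - (p : ℝ)⁻¹)| ≤
          C * z ^ (-η) * (H * ∏ p ∈ Nat.primesBelow ⌈z⌉₊, (1 - (p : ℝ)⁻¹)) ∧
        A.densityProduct (primesProdBelow z) ≤ C / Real.log z :=
  FI1978_lemma7_rat
    { a := fun _ => 0, a_nonneg := fun _ => le_rfl, size := fun _ => 0,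
      density := A.density, density_mult := A.density_mult }
    (isBombieriSequence_nullWithDensity A h1 h5)

/-- **Sieve dimension `1` under (A₁), (A₅) and `g ≥ 0`**: `HasSieveDimension g 1 K` for some `K`
(the tree's `BombieriSieve.hasSieveDimension`, i.e. Lemma 7 + Mertens, applied to the null sequence
with the density of `𝒜`). [folklore] -/
theorem hasSieveDimension_of_A1_A5 (A : SieveSequence) (h1 : A.BombieriA1) (h5 : A.BombieriA5)
    (hg : ∀ d : ℕ, 1 ≤ d → 0 ≤ A.density d) : ∃ K : ℝ, HasSieveDimension A.density 1 K :=
  hasSieveDimension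
    { a := fun _ => 0, a_nonneg := fun _ => le_rfl, size := fun _ => 0,
      density := A.density, density_mult := A.density_mult }
    (isBombieriSequence_nullWithDensity A h1 h5) hg

/-- **[FriedlanderIwaniecPisa1978] Lemma 9 (`K = ℚ`, `N = 1`) under (A₁), (A₅) alone**: if
`A.HasDensityConstant H` then for some `η > 0`, `C` and all `2 ≤ z ≤ x`,
`∑_{d ≤ x, (d, P(z)) = 1} |g(d) V(z) − H ∏_{p<z}(1 − 1/p)/d| ≤ C z^{−η} log x/log z` (the tree's
`BombieriSieve.FI1978_lemma9_rat` applied to the null sequence with the density of `𝒜`).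
[cite: FriedlanderIwaniecPisa1978, Lemma 9 (K = Q, N = 1)] -/
theorem FI1978_lemma9_of_A1_A5 (A : SieveSequence) (H : ℝ) (h1 : A.BombieriA1) (h5 : A.BombieriA5)
    (hH : A.HasDensityConstant H) :
    ∃ η : ℝ, 0 < η ∧ ∃ C : ℝ, ∀ x z : ℝ, 2 ≤ z → z ≤ x →
      ∑ d ∈ (Finset.Ioc 0 ⌊x⌋₊).filter (fun d : ℕ => d.Coprime (primesProdBelow z)),
        |A.density d * A.densityProduct (primesProdBelow z) -
          H * (∏ p ∈ Nat.primesBelow ⌈z⌉₊, (1 - (p : ℝ)⁻¹)) / d| ≤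
        C * z ^ (-η) * Real.log x / Real.log z :=
  FI1978_lemma9_rat
    { a := fun _ => 0, a_nonneg := fun _ => le_rfl, size := fun _ => 0,
      density := A.density, density_mult := A.density_mult }
    H (isBombieriSequence_nullWithDensity A h1 h5) hH

/-! ### The dichotomy `g ≥ 0` or `A ≡ 0` from (A₂) at a finite level -/

/-- **Dichotomy at level `x^{θ₀}`.** If `A(x) = ∑_{n ≤ x} a_n` and (A₂) holds at some level
`x^{θ₀}`, `θ₀ > 0` (`SieveSequence.BombieriA2At`), then either `g(d) ≥ 0` for all `d ≥ 1` or
`A(x) = 0` for every `x`: if `A(x₀) > 0` and `g(d) < 0` then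
`R(x; d) = A(x; d) − g(d)A(x) ≥ |g(d)| A(x)`, while (A₂) with `ε = θ₀/2`, `B = 1` gives
`|R(x; d)| ≤ C A(x)/log x` once `d < x^{θ₀/2}` — the proof of the tree's
`BombieriSieve.density_nonneg_or_size_eq_zero` (`θ₀ = 1`) at a general level. [folklore] -/
theorem density_nonneg_or_size_eq_zero_of_bombieriA2At (A : SieveSequence)
    (hsize : ∀ x, A.size x = A.congrSum 1 x) {θ₀ : ℝ} (hθ₀ : 0 < θ₀) (h2 : A.BombieriA2At θ₀) :
    (∀ d : ℕ, 1 ≤ d → 0 ≤ A.density d) ∨ ∀ x : ℝ, A.size x = 0 := by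
  by_contra h
  rw [not_or, not_forall, not_forall] at h
  obtain ⟨⟨d, hd⟩, ⟨x₀, hx₀⟩⟩ := h
  rw [Classical.not_imp, not_le] at hd
  obtain ⟨hd1, hgd⟩ := hd
  -- `A(x) ≥ A(x₀) > 0` for `x ≥ x₀`
  have hsz_nonneg : ∀ x, 0 ≤ A.size x := SieveSequence.size_nonneg_of_size_eq hsize
  have hpos : 0 < A.size x₀ := lt_of_le_of_ne (hsz_nonneg x₀) (Ne.symm hx₀)
  have hmono : ∀ x, x₀ ≤ x → A.size x₀ ≤ A.size x := by
    intro x hx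
    rw [hsize, hsize, SieveSequence.congrSum, SieveSequence.congrSum]
    exact Finset.sum_le_sum_of_subset_of_nonneg
      (Finset.filter_subset_filter _ (Finset.Ioc_subset_Ioc_right (Nat.floor_le_floor hx)))
      fun n _ _ => A.a_nonneg n
  -- (A₂) at level `x^{θ₀/2}`, `B = 1`
  obtain ⟨C, hC⟩ := h2 (θ₀ / 2) (by positivity) 1 one_pos
  have hev : ∀ᶠ x : ℝ in atTop, |A.density d| * A.size x ≤ C * A.size x / Real.log x := by
    filter_upwards [hC,
      (tendsto_rpow_atTop (by positivity : 0 < θ₀ / 2)).eventually_gt_atTop (d : ℝ)] with x hx hxd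
    have hsel := hx (fun _ => x) fun _ => le_rfl
    -- the term `d` lies in the range `d < x^{θ₀/2}`
    have hdmem : d ∈ Finset.Ico 1 ⌈x ^ (θ₀ - θ₀ / 2)⌉₊ := by
      rw [Finset.mem_Ico]
      refine ⟨hd1, Nat.lt_ceil.mpr ?_⟩
      rwa [show θ₀ - θ₀ / 2 = θ₀ / 2 by ring]
    have hterm : |A.remainder d x| ≤ C * A.size x / Real.log x ^ (1 : ℝ) :=
      le_trans (Finset.single_le_sum (f := fun i => |A.remainder i x|) (fun _ _ => abs_nonneg _)
        hdmem) hsel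
    rw [Real.rpow_one] at hterm
    refine le_trans ?_ hterm
    -- `|g d| A(x) ≤ |R(x; d)|` since `R = A_d − g A ≥ −g A = |g| A`
    have hR : A.remainder d x = A.congrSum d x - A.density d * A.size x := rfl
    have hcs : 0 ≤ A.congrSum d x := Finset.sum_nonneg fun n _ => A.a_nonneg n
    rw [abs_of_neg hgd]
    calc -A.density d * A.size x ≤ A.remainder d x := by rw [hR]; linarith
      _ ≤ |A.remainder d x| := le_abs_self _
  -- choose `x` large: `x ≥ x₀`, `x > 1`, `log x > C / |g d| + 1`
  have hgd' : 0 < |A.density d| := abs_pos.mpr hgd.ne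
  obtain ⟨x, hx, hxx₀, hx1, hxlog⟩ := (hev.and ((eventually_ge_atTop x₀).and
    ((eventually_gt_atTop (1 : ℝ)).and
      (Real.tendsto_log_atTop.eventually_gt_atTop (C / |A.density d| + 1))))).exists
  have hAx : 0 < A.size x := lt_of_lt_of_le hpos (hmono x hxx₀)
  have hlogpos : 0 < Real.log x := Real.log_pos hx1
  have key : |A.density d| * A.size x ≤ C * A.size x / Real.log x := hx
  -- divide by `A(x) > 0`: `|g d| log x ≤ C`
  have h1 : |A.density d| * Real.log x ≤ C := by
    have := key
    rw [le_div_iff₀ hlogpos] at this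
    nlinarith
  have h2 : C < |A.density d| * Real.log x := by
    have := hxlog
    have h3 : C / |A.density d| < Real.log x := by linarith
    rwa [div_lt_iff₀ hgd', mul_comm] at h3
  linarith

/-! ### [FriedlanderIwaniecPisa1978] Lemma 11 with the (A₂)-input displayed -/

/-- **[FriedlanderIwaniecPisa1978] Lemma 11 at a finite level** (p. 738: "If `zy < x` and
`z x^{1/2} < y < x^{1−ε}`, then `Σ₂ ≪ A(x)(log x/y)^{a+1}(log x)^{|k′|}(log z)^{−2}`", scalar case
`|k′| = 0`, `a = k`), for a sequence with `A(x) = ∑_{n ≤ x} a_n`, (A₁), (A₅) and `g ≥ 0`, the single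
use of (A₂) in the printed proof — for the distinct moduli `νd ≤ z² x/y < x^{1−ε}` — being replaced
by its output at the point `x`: there is `C` (depending on the density only) such that for every
`ε > 0` and every `C₂`, for all large `x`, IF `∑_{d < x^{1−ε}} |R(y_d; d)| ≤ C₂ A(x)(log x)^{−3}`
for all selections `y_d ≤ x`, THEN `|Σ₂| ≤ C A(x)(log x/y)^{k+1}(log z)^{−2}` for all `y, z` in the
printed ranges. The proof is that of the tree's `BombieriSieve.FI1978_lemma11_of_fundamentalLemma`
(`abs_sigma2_le`, the fundamental lemma `SieveSequence.fundamental_lemma_uniform_holds` at level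
`z²` for each `𝒜_m`, `sum_coprime_sum_divisors_le`, Lemma 7, Lemma 8), with the (A₂)-constant `C₂`
entering only the threshold `log x ≥ max(1, C₂)`. [cite: FriedlanderIwaniecPisa1978, Lemma 11] -/
theorem FI1978_lemma11_finiteLevel (A : SieveSequence) (hsize : ∀ x, A.size x = A.congrSum 1 x)
    (h1 : A.BombieriA1) (h5 : A.BombieriA5) (hg : ∀ d : ℕ, 1 ≤ d → 0 ≤ A.density d) (k : ℕ) :
    ∃ C : ℝ, ∀ ε : ℝ, 0 < ε → ∀ C₂ : ℝ, ∀ᶠ x : ℝ in atTop,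
      (∀ y : ℕ → ℝ, (∀ d, y d ≤ x) →
        ∑ d ∈ Ico 1 ⌈x ^ (1 - ε)⌉₊, |A.remainder d (y d)| ≤
          C₂ * A.size x / Real.log x ^ ((3 : ℕ) : ℝ)) →
      ∀ y z : ℝ, 2 ≤ z → z * y < x → z * Real.sqrt x < y → y < x ^ (1 - ε) →
        |sigma2 A k x y z| ≤ C * A.size x * Real.log (x / y) ^ (k + 1) / Real.log z ^ 2 := by
  have hA0 : ∀ x, 0 ≤ A.size x := SieveSequence.size_nonneg_of_size_eq hsize
  -- the constants: sieve dimension, fundamental lemma, Lemma 7, Lemma 8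
  obtain ⟨K, hK⟩ := hasSieveDimension_of_A1_A5 A h1 h5 hg
  obtain ⟨CF, hCF0, hFL'⟩ := SieveSequence.fundamental_lemma_uniform_holds 1 K
  obtain ⟨H, -, -, η, -, C₇, h7⟩ := FI1978_lemma7_of_A1_A5 A h1 h5
  obtain ⟨C₈, h8⟩ := FI1978_lemma8_rat A h1 h5
  set C₇' := max C₇ 1 with hC₇'
  set C₈' := max C₈ 1 with hC₈'
  have hC₇'0 : 0 ≤ C₇' := zero_le_one.trans (le_max_right _ _)
  have hC₈'0 : 0 ≤ C₈' := zero_le_one.trans (le_max_right _ _)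
  refine ⟨(1 + CF) * C₇' * C₈' + 1, fun ε hε C₂ => ?_⟩
  filter_upwards [eventually_ge_atTop (1 : ℝ),
    Real.tendsto_log_atTop.eventually_ge_atTop (max 1 C₂)] with x hx1 hxlog hx2 y z hz hzy hzx hyx
  -- the parameters
  have hx0 : 0 < x := by linarith
  have hlogx1 : 1 ≤ Real.log x := (le_max_left _ _).trans hxlog
  have hC₂log : C₂ ≤ Real.log x := (le_max_right _ _).trans hxlog
  have hz0 : 0 < z := by linarith
  have hz1 : 1 < z := by linarith
  have hsqrt1 : 1 ≤ Real.sqrt x := by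
    rw [← Real.sqrt_one]
    exact Real.sqrt_le_sqrt hx1
  have hsqrt0 : 0 < Real.sqrt x := by linarith
  have hy2 : 2 ≤ y := by nlinarith
  have hy0 : 0 < y := by linarith
  have hy1 : 1 ≤ y := by linarith
  have hyx' : y ≤ x := by
    refine hyx.le.trans ?_
    calc x ^ (1 - ε) ≤ x ^ (1 : ℝ) := Real.rpow_le_rpow_of_exponent_le hx1 (by linarith)
      _ = x := Real.rpow_one x
  have hzxy : z < x / y := by rwa [lt_div_iff₀ hy0]
  have hxy0 : 0 ≤ x / y := div_nonneg hx0.le hy0.le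
  have hzx' : z ≤ x := hzxy.le.trans (div_le_self hx0.le hy1)
  have hlogz : 0 < Real.log z := Real.log_pos hz1
  have hlogxy : Real.log z ≤ Real.log (x / y) := Real.log_le_log hz0 hzxy.le
  have hlogxy0 : 0 < Real.log (x / y) := hlogz.trans_le hlogxy
  have hlogzx : Real.log z ≤ Real.log x := Real.log_le_log hz0 hzx'
  -- the level: `z² · x/y < z √x < y < x^{1−ε}`
  have hlevel : x / y * z ^ 2 < x ^ (1 - ε) := by
    have h1 : x / y * z ^ 2 < z * Real.sqrt x := by
      rw [div_mul_eq_mul_div, div_lt_iff₀ hy0]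
      have hsx : Real.sqrt x ^ 2 = x := Real.sq_sqrt hx0.le
      have h2 : Real.sqrt x * z < y := by linarith
      calc x * z ^ 2 = (Real.sqrt x * z) * (z * Real.sqrt x) := by
            linear_combination (-(z ^ 2)) * hsx
        _ < y * (z * Real.sqrt x) := mul_lt_mul_of_pos_right h2 (mul_pos hz0 hsqrt0)
        _ = z * Real.sqrt x * y := by ring
    exact h1.trans (hzx.trans hyx)
  set P := primesProdBelow z with hP
  set V := A.densityProduct P with hV
  have hVle : V ≤ C₇' / Real.log z :=
    (h7 z hz).2.trans (div_le_div_of_nonneg_right (le_max_left _ _) hlogz.le)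
  have hV0 : 0 ≤ V := by
    rw [hV, densityProduct_primesProdBelow]
    exact Finset.prod_nonneg fun p hp =>
      (sub_pos.mpr (h1.2 p (Nat.prime_of_mem_primesBelow hp).one_lt)).le
  have hAx := hA0 x
  -- Step 1: `|Σ₂| ≤ (log x/y)^k ∑_m S(𝒜_m, z; x)`
  have h1' := abs_sigma2_le A k z hy0 hyx'
  rw [← hP] at h1'
  -- Step 2: the fundamental lemma (upper half) for each `𝒜_m`, `(m, P(z)) = 1`, at level `z²`
  have hFLm : ∀ m ∈ (Ioc 0 ⌊x / y⌋₊).filter (fun m : ℕ => m.Coprime P),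
      (A.restrictDvd m).sifted x P ≤ (1 + CF) * A.size x * V * |A.density m| +
        ∑ d ∈ P.divisors.filter (fun d : ℕ => (d : ℝ) ≤ z ^ 2), |A.remainder (m * d) x| := by
    intro m hm
    obtain ⟨hm', hmP⟩ := Finset.mem_filter.mp hm
    have hm1 : 1 ≤ m := (Finset.mem_Ioc.mp hm').1
    have hgm : 0 ≤ A.density m := hg m hm1
    have hsz : 0 ≤ A.density m * A.size x := mul_nonneg hgm hAx
    have hzz : z ≤ z ^ 2 := by nlinarith
    have h : |(A.restrictDvd m).sifted x P - A.density m * A.size x * V| ≤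
        CF * (A.density m * A.size x) * V * Real.exp (-(Real.log (z ^ 2) / Real.log z)) +
          ∑ d ∈ P.divisors.filter (fun d : ℕ => (d : ℝ) ≤ z ^ 2),
            |(A.restrictDvd m).remainder d x| :=
      hFL' (A.restrictDvd m) hK x z (z ^ 2) hz hzz hsz
    have hrem : ∑ d ∈ P.divisors.filter (fun d : ℕ => (d : ℝ) ≤ z ^ 2),
        |(A.restrictDvd m).remainder d x| =
        ∑ d ∈ P.divisors.filter (fun d : ℕ => (d : ℝ) ≤ z ^ 2), |A.remainder (m * d) x| := by
      refine Finset.sum_congr rfl fun d hd => ?_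
      have hdP : d ∣ P := Nat.dvd_of_mem_divisors (Finset.mem_filter.mp hd).1
      rw [remainder_restrictDvd A (hmP.coprime_dvd_right hdP)]
    rw [hrem] at h
    have hexp : Real.exp (-(Real.log (z ^ 2) / Real.log z)) ≤ 1 := by
      rw [Real.exp_le_one_iff, neg_nonpos]
      exact div_nonneg (Real.log_nonneg (by nlinarith)) hlogz.le
    have hup := (abs_sub_le_iff.mp h).1
    have hgAV : 0 ≤ CF * (A.density m * A.size x) * V := mul_nonneg (mul_nonneg hCF0.le hsz) hV0
    have hmain : A.density m * A.size x * V +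
        CF * (A.density m * A.size x) * V * Real.exp (-(Real.log (z ^ 2) / Real.log z)) ≤
        (1 + CF) * A.size x * V * |A.density m| := by
      rw [abs_of_nonneg hgm]
      calc A.density m * A.size x * V +
            CF * (A.density m * A.size x) * V * Real.exp (-(Real.log (z ^ 2) / Real.log z))
          ≤ A.density m * A.size x * V + CF * (A.density m * A.size x) * V * 1 := by
            gcongr
        _ = (1 + CF) * A.size x * V * A.density m := by ring
    linarith
  -- Step 3: summing over `m`: Lemma 8 for the main terms, rearrangement + (A₂) for the remainders
  have h8' : ∑ m ∈ (Ioc 0 ⌊x / y⌋₊).filter (fun m : ℕ => m.Coprime P), |A.density m| ≤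
      C₈' * Real.log (x / y) / Real.log z := by
    refine (h8 (x / y) z hz hzxy.le).trans ?_
    exact div_le_div_of_nonneg_right (mul_le_mul_of_nonneg_right (le_max_left _ _) hlogxy0.le)
      hlogz.le
  have hR : ∑ m ∈ (Ioc 0 ⌊x / y⌋₊).filter (fun m : ℕ => m.Coprime P),
      ∑ d ∈ P.divisors.filter (fun d : ℕ => (d : ℝ) ≤ z ^ 2), |A.remainder (m * d) x| ≤
      C₂ * A.size x / Real.log x ^ 3 := by
    have hM : ∀ m ∈ (Ioc 0 ⌊x / y⌋₊).filter (fun m : ℕ => m.Coprime P), m ≠ 0 ∧ m.Coprime P :=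
      fun m hm => ⟨(Finset.mem_Ioc.mp (Finset.mem_filter.mp hm).1).1.ne',
        (Finset.mem_filter.mp hm).2⟩
    have hL : ∀ m ∈ (Ioc 0 ⌊x / y⌋₊).filter (fun m : ℕ => m.Coprime P),
        (m : ℝ) * z ^ 2 < x ^ (1 - ε) := by
      intro m hm
      have hmX : (m : ℝ) ≤ x / y :=
        (Nat.cast_le.mpr (Finset.mem_Ioc.mp (Finset.mem_filter.mp hm).1).2).trans
          (Nat.floor_le hxy0)
      exact (mul_le_mul_of_nonneg_right hmX (sq_nonneg z)).trans_lt hlevel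
    have hre := sum_coprime_sum_divisors_le (primesProdBelow_ne_zero z)
      (fun q => |A.remainder q x|) (fun q => abs_nonneg _) _ hM (z ^ 2) (x ^ (1 - ε)) hL
    refine hre.trans ?_
    have := hx2 (fun _ => x) fun _ => le_rfl
    rwa [Real.rpow_natCast] at this
  have hsumS : ∑ m ∈ (Ioc 0 ⌊x / y⌋₊).filter (fun m : ℕ => m.Coprime P),
      (A.restrictDvd m).sifted x P ≤
      (1 + CF) * A.size x * V * (C₈' * Real.log (x / y) / Real.log z) +
        C₂ * A.size x / Real.log x ^ 3 := by
    refine (Finset.sum_le_sum hFLm).trans ?_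
    rw [Finset.sum_add_distrib, ← Finset.mul_sum]
    refine add_le_add (mul_le_mul_of_nonneg_left h8' ?_) hR
    exact mul_nonneg (mul_nonneg (by linarith) hAx) hV0
  -- Step 4: arithmetic
  have hT1 : (1 + CF) * A.size x * V * (C₈' * Real.log (x / y) / Real.log z) ≤
      (1 + CF) * C₇' * C₈' * A.size x * Real.log (x / y) / Real.log z ^ 2 := by
    have hnn : 0 ≤ (1 + CF) * A.size x * (C₈' * Real.log (x / y) / Real.log z) :=
      mul_nonneg (mul_nonneg (by linarith) hAx)
        (div_nonneg (mul_nonneg hC₈'0 hlogxy0.le) hlogz.le)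
    calc (1 + CF) * A.size x * V * (C₈' * Real.log (x / y) / Real.log z)
        = (1 + CF) * A.size x * (C₈' * Real.log (x / y) / Real.log z) * V := by ring
      _ ≤ (1 + CF) * A.size x * (C₈' * Real.log (x / y) / Real.log z) * (C₇' / Real.log z) :=
          mul_le_mul_of_nonneg_left hVle hnn
      _ = (1 + CF) * C₇' * C₈' * A.size x * Real.log (x / y) / Real.log z ^ 2 := by
          field_simp
  have hT2 : C₂ * A.size x / Real.log x ^ 3 ≤ A.size x * Real.log (x / y) / Real.log z ^ 2 := by
    have hlx0 : 0 < Real.log x := by linarith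
    have ha : C₂ / Real.log x ^ 3 ≤ 1 / Real.log x := by
      rw [div_le_div_iff₀ (pow_pos hlx0 3) hlx0]
      have : C₂ * Real.log x ≤ Real.log x * Real.log x := mul_le_mul_of_nonneg_right hC₂log hlx0.le
      nlinarith
    have hb : 1 / Real.log x ≤ 1 / Real.log z := one_div_le_one_div_of_le hlogz hlogzx
    have hc : 1 / Real.log z ≤ Real.log (x / y) / Real.log z ^ 2 := by
      rw [div_le_div_iff₀ hlogz (pow_pos hlogz 2), one_mul, pow_two]
      exact mul_le_mul_of_nonneg_right hlogxy hlogz.le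
    calc C₂ * A.size x / Real.log x ^ 3 = A.size x * (C₂ / Real.log x ^ 3) := by ring
      _ ≤ A.size x * (Real.log (x / y) / Real.log z ^ 2) :=
          mul_le_mul_of_nonneg_left (ha.trans (hb.trans hc)) hAx
      _ = A.size x * Real.log (x / y) / Real.log z ^ 2 := by ring
  calc |sigma2 A k x y z|
      ≤ Real.log (x / y) ^ k * ∑ m ∈ (Ioc 0 ⌊x / y⌋₊).filter (fun m : ℕ => m.Coprime P),
          (A.restrictDvd m).sifted x P := h1'
    _ ≤ Real.log (x / y) ^ k * ((1 + CF) * C₇' * C₈' * A.size x * Real.log (x / y) /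
          Real.log z ^ 2 + A.size x * Real.log (x / y) / Real.log z ^ 2) :=
        mul_le_mul_of_nonneg_left (hsumS.trans (add_le_add hT1 hT2)) (pow_nonneg hlogxy0.le k)
    _ = ((1 + CF) * C₇' * C₈' + 1) * A.size x * Real.log (x / y) ^ (k + 1) / Real.log z ^ 2 := by
        ring

/-! ### [FriedlanderIwaniecPisa1978] Lemma 12 with the (A₂)-input displayed -/

/-- **[FriedlanderIwaniecPisa1978] Lemma 12 at a finite level** (p. 738: "Let `ε > 0`. If `s ≥ 2`,
`z ≥ 2` and `z^s y ≤ x^{1−ε}`, then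
`Σ₁ = H A(x) F + O{(e^{−s} + β(x) + c(ε)/log x + z^{−η} log x) A(x)(log x)^{|k|−1}(log x/log z)²}`",
scalar case, `k = j + 2`), for a sequence with `A(x) = ∑_{n ≤ x} a_n`, (A₁), (A₅),
`A.HasDensityConstant H` and `g ≥ 0`, the single use of (A₂) in the printed proof — "partial
summation (twice)" over the distinct moduli `νd < z^s y ≤ x^{1−ε}` with `sup_{t ≤ x}` — being
replaced by its output at the point `x`: there are `η > 0` and `C` such that for every `ε > 0`,
`s ≥ 2` and every `C₂`, for all large `x`, IF
`∑_{d < x^{1−ε}} |R(y_d; d)| ≤ C₂ A(x)(log x)^{−(k+1)}` for all selections `y_d ≤ x`, THEN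
`|Σ₁ − H A(x) F| ≤ C E (log x/log z)²` with
`E = e^{−s} A(x)(log x)^{k−1} + (∫₁^x A(t)dt/t)(log x)^{k−2} + z^{−η} A(x)(log x)^k`, for all
`y ≥ 1`, `z ≥ 2` with `z^s y ≤ x^{1−ε}` (`F = BombieriSieve.mainTermF`). The proof is that of the
tree's `BombieriSieve.FI1978_lemma12_of_fundamentalLemma` (the fundamental lemma for the weighted
subsequences `weighted_sifted_sub_le`, `abs_weighted_congrSum_sub_le`,
`size_mul_pow_log_sub_weightedSum_bounds`, `integral_size_div_eq`, Lemmata 7, 8, 9), with the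
(A₂)-constant `C₂` entering only the threshold `log x ≥ max(1, 2 C₂ e^s)` (absorbing the printed
`c(ε)/log x` into `e^{−s}`). [cite: FriedlanderIwaniecPisa1978, Lemma 12] -/
theorem FI1978_lemma12_finiteLevel (A : SieveSequence) (H : ℝ)
    (hsize : ∀ x, A.size x = A.congrSum 1 x) (h1 : A.BombieriA1) (h5 : A.BombieriA5)
    (hH : A.HasDensityConstant H)
    (hg : ∀ d : ℕ, 1 ≤ d → 0 ≤ A.density d) (j : ℕ) :
    ∃ η : ℝ, 0 < η ∧ ∃ C : ℝ, ∀ ε : ℝ, 0 < ε → ∀ s : ℝ, 2 ≤ s → ∀ C₂ : ℝ, ∀ᶠ x : ℝ in atTop,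
      (∀ y : ℕ → ℝ, (∀ d, y d ≤ x) →
        ∑ d ∈ Ico 1 ⌈x ^ (1 - ε)⌉₊, |A.remainder d (y d)| ≤
          C₂ * A.size x / Real.log x ^ ((j + 3 : ℕ) : ℝ)) →
      ∀ y z : ℝ, 2 ≤ z → 1 ≤ y → z ^ s * y ≤ x ^ (1 - ε) →
        |sigma1 A (j + 2) x y z - H * A.size x * mainTermF (j + 2) x y z| ≤
          C * (Real.exp (-s) * A.size x * Real.log x ^ (j + 1) +
                (∫ t in (1 : ℝ)..x, A.size t / t) * Real.log x ^ j +
                z ^ (-η) * A.size x * Real.log x ^ (j + 2)) *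
            (Real.log x / Real.log z) ^ 2 := by
  have hA0 : ∀ x, 0 ≤ A.size x := SieveSequence.size_nonneg_of_size_eq hsize
  have hAsum : ∀ x : ℝ, ∑ n ∈ Ioc 0 ⌊x⌋₊, A.a n = A.size x := fun x => by
    rw [hsize x, SieveSequence.congrSum, Finset.filter_true_of_mem (fun n _ => one_dvd n)]
  -- the constants
  obtain ⟨K, hK⟩ := hasSieveDimension_of_A1_A5 A h1 h5 hg
  obtain ⟨CF, hCF0, hFL'⟩ := SieveSequence.fundamental_lemma_uniform_holds 1 K
  obtain ⟨H₇, hH₇0, hH₇, η₇, hη₇, C₇, h7⟩ := FI1978_lemma7_of_A1_A5 A h1 h5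
  have hHH : H = H₇ := tendsto_nhds_unique hH hH₇
  subst hHH
  obtain ⟨C₈, h8⟩ := FI1978_lemma8_rat A h1 h5
  obtain ⟨η, hη0, C₉, h9⟩ := FI1978_lemma9_of_A1_A5 A H h1 h5 hH
  set C₇' := max C₇ 0 with hC₇'
  set C₈' := max C₈ 0 with hC₈'
  set C₉' := max C₉ 0 with hC₉'
  have hC₇'0 : 0 ≤ C₇' := le_max_right _ _
  have hC₈'0 : 0 ≤ C₈' := le_max_right _ _
  have hC₉'0 : 0 ≤ C₉' := le_max_right _ _
  refine ⟨η, hη0, CF * C₇' * C₈' + 1 + (j + 2) * C₇' * C₈' + C₉', fun ε hε s hs C₂ => ?_⟩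
  filter_upwards [eventually_ge_atTop (1 : ℝ),
    Real.tendsto_log_atTop.eventually_ge_atTop (max 1 (2 * C₂ * Real.exp s))]
    with x hx1 hxlog hx2 y z hz hy1 hlev
  -- the parameters
  have hx0 : 0 < x := by linarith
  have hlogx1 : 1 ≤ Real.log x := (le_max_left _ _).trans hxlog
  have hC₂log : 2 * C₂ * Real.exp s ≤ Real.log x := (le_max_right _ _).trans hxlog
  have hz0 : 0 < z := by linarith
  have hz1 : 1 < z := by linarith
  have hy0 : 0 < y := by linarith
  have hzs : z ≤ z ^ s := by
    calc z = z ^ (1 : ℝ) := (Real.rpow_one z).symm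
      _ ≤ z ^ s := Real.rpow_le_rpow_of_exponent_le hz1.le (by linarith)
  have hzs0 : 0 < z ^ s := Real.rpow_pos_of_pos hz0 s
  have hx1ε : x ^ (1 - ε) ≤ x := by
    calc x ^ (1 - ε) ≤ x ^ (1 : ℝ) := Real.rpow_le_rpow_of_exponent_le hx1 (by linarith)
      _ = x := Real.rpow_one x
  have hyx : y ≤ x := by
    have h1 : y ≤ z ^ s * y := le_mul_of_one_le_left hy0.le (hz1.le.trans hzs)
    linarith
  have hzx : z ≤ x := by
    have h1 : z ^ s ≤ z ^ s * y := le_mul_of_one_le_right hzs0.le hy1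
    linarith
  have hlogz : 0 < Real.log z := Real.log_pos hz1
  have hlogzx : Real.log z ≤ Real.log x := Real.log_le_log hz0 hzx
  have hlx0 : 0 < Real.log x := by linarith
  set N := ⌊x⌋₊ with hN
  have hNx : (N : ℝ) ≤ x := Nat.floor_le hx0.le
  set P := primesProdBelow z with hP
  set V := A.densityProduct P with hV
  set P₁ := ∏ p ∈ Nat.primesBelow ⌈z⌉₊, (1 - (p : ℝ)⁻¹) with hP₁
  set L := Real.log x with hL
  set Ax := A.size x with hAx
  have hAx0 : 0 ≤ Ax := hA0 x
  have hV0 : 0 ≤ V := by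
    rw [hV, densityProduct_primesProdBelow]
    exact Finset.prod_nonneg fun p hp =>
      (sub_pos.mpr (h1.2 p (Nat.prime_of_mem_primesBelow hp).one_lt)).le
  have hVle : V ≤ C₇' / Real.log z :=
    (h7 z hz).2.trans (div_le_div_of_nonneg_right (le_max_left _ _) hlogz.le)
  -- the auxiliary height `X₁ = max y z ≤ x` for Lemmata 8, 9
  set X₁ := max y z with hX₁
  have hzX₁ : z ≤ X₁ := le_max_right _ _
  have hX₁x : X₁ ≤ x := max_le hyx hzx
  have hlogX₁ : Real.log X₁ ≤ L := Real.log_le_log (hz0.trans_le hzX₁) hX₁x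
  set M := (Ico 1 ⌈y⌉₊).filter (fun d : ℕ => d.Coprime P) with hM
  have hmemM : ∀ {d : ℕ}, d ∈ M → (1 ≤ d ∧ (d : ℝ) < y) ∧ d.Coprime P := by
    intro d hd
    obtain ⟨hd', hdP⟩ := Finset.mem_filter.mp hd
    obtain ⟨hd1, hdy⟩ := Finset.mem_Ico.mp hd'
    exact ⟨⟨hd1, Nat.lt_ceil.mp hdy⟩, hdP⟩
  have hMsub : M ⊆ (Ioc 0 ⌊X₁⌋₊).filter (fun d : ℕ => d.Coprime P) := by
    intro d hd
    obtain ⟨⟨hd1, hdy⟩, hdP⟩ := hmemM hd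
    refine Finset.mem_filter.mpr ⟨Finset.mem_Ioc.mpr ⟨hd1, Nat.le_floor ?_⟩, hdP⟩
    exact hdy.le.trans (le_max_left _ _)
  -- Lemma 8 and Lemma 9 over `M`
  have hG : ∑ d ∈ M, |A.density d| ≤ C₈' * L / Real.log z := by
    refine (Finset.sum_le_sum_of_subset_of_nonneg hMsub fun _ _ _ => abs_nonneg _).trans ?_
    refine (h8 X₁ z hz hzX₁).trans ?_
    rw [div_le_div_iff_of_pos_right hlogz]
    exact mul_le_mul (le_max_left _ _) hlogX₁ (Real.log_nonneg (hz1.le.trans hzX₁)) hC₈'0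
  have hS9 : ∑ d ∈ M, |A.density d * V - H * P₁ / d| ≤ C₉' * z ^ (-η) * L / Real.log z := by
    refine (Finset.sum_le_sum_of_subset_of_nonneg hMsub fun _ _ _ => abs_nonneg _).trans ?_
    refine (h9 X₁ z hz hzX₁).trans ?_
    rw [div_le_div_iff_of_pos_right hlogz]
    have hzη : 0 ≤ z ^ (-η) := Real.rpow_nonneg hz0.le _
    exact mul_le_mul (mul_le_mul_of_nonneg_right (le_max_left _ _) hzη) hlogX₁
      (Real.log_nonneg (hz1.le.trans hzX₁)) (mul_nonneg hC₉'0 hzη)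
  -- the weights `φ_d`, the sums `T_d`, `W_d`, and `β`
  set w : ℕ → ℕ → ℝ := fun d n => max 0 (Real.log ((n : ℝ) / d)) ^ (j + 2) with hw
  set T : ℕ → ℝ := fun d => ∑ n ∈ Ioc 0 N, A.a n * w d n with hT
  set W : ℕ → ℝ := fun d =>
    ∑ n ∈ (Ioc 0 N).filter (fun n : ℕ => n.Coprime P ∧ d ∣ n), A.a n * w d n with hW
  set I := ∑ n ∈ Ioc 0 N, A.a n * (L - Real.log n) with hI
  have hIeq : ∫ t in (1 : ℝ)..x, A.size t / t = I := integral_size_div_eq A hsize hx1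
  have hI0 : 0 ≤ I := Finset.sum_nonneg fun n hn => by
    have hn := Finset.mem_Ioc.mp hn
    refine mul_nonneg (A.a_nonneg n) (sub_nonneg.mpr (Real.log_le_log ?_ ?_))
    · exact_mod_cast hn.1
    · exact (Nat.cast_le.mpr hn.2).trans hNx
  have hwprops : ∀ {d : ℕ}, 1 ≤ d → (∀ n, 0 ≤ w d n) ∧ Monotone (w d) ∧
      ∀ n : ℕ, d ∣ n → 1 ≤ n → w d n = Real.log ((n : ℝ) / d) ^ (j + 2) :=
    fun hd => logWeight_props (j + 2) hd fun n => rfl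
  have hwN : ∀ {d : ℕ}, 1 ≤ d → w d N ≤ L ^ (j + 2) := by
    intro d hd
    have hd0 : (0 : ℝ) < d := by exact_mod_cast hd
    refine pow_le_pow_left₀ (le_max_left _ _) (max_le hlx0.le ?_) _
    rcases Nat.eq_zero_or_pos N with hN0 | hNpos
    · rw [hN0, Nat.cast_zero, zero_div, Real.log_zero]
      exact hlx0.le
    · calc Real.log ((N : ℝ) / d) ≤ Real.log N :=
            Real.log_le_log (div_pos (by exact_mod_cast hNpos) hd0)
              (div_le_self (Nat.cast_nonneg N) (by exact_mod_cast hd))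
        _ ≤ L := Real.log_le_log (by exact_mod_cast hNpos) hNx
  -- `T_d` against `A(x) (log x/d)^k`
  have hTd : ∀ {d : ℕ}, d ∈ M →
      0 ≤ Ax * Real.log (x / d) ^ (j + 2) - T d ∧
        Ax * Real.log (x / d) ^ (j + 2) - T d ≤ (j + 2 : ℕ) * L ^ (j + 1) * I ∧
        T d ≤ Ax * L ^ (j + 2) := by
    intro d hd
    obtain ⟨⟨hd1, hdy⟩, -⟩ := hmemM hd
    have hdx : (d : ℝ) ≤ x := hdy.le.trans hyx
    have h := size_mul_pow_log_sub_weightedSum_bounds A (k := j + 2) hd1 hdx (w := w d)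
      fun n => rfl
    rw [hAsum x, show j + 2 - 1 = j + 1 from by omega] at h
    refine ⟨h.1, h.2, ?_⟩
    have hd0 : (0 : ℝ) < d := by exact_mod_cast hd1
    have hlxd : Real.log (x / d) ≤ L := by
      rw [Real.log_div hx0.ne' hd0.ne']
      linarith [Real.log_nonneg (show (1 : ℝ) ≤ d by exact_mod_cast hd1)]
    have hlxd0 : 0 ≤ Real.log (x / d) := Real.log_nonneg ((one_le_div hd0).mpr hdx)
    calc T d ≤ Ax * Real.log (x / d) ^ (j + 2) := by linarith [h.1]
      _ ≤ Ax * L ^ (j + 2) := mul_le_mul_of_nonneg_left (pow_le_pow_left₀ hlxd0 hlxd _) hAx0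
  -- the selection `m_q ≤ N` maximising `|R(m; q)|`, and (A₂)
  have hne : (Finset.range (N + 1)).Nonempty := ⟨0, by simp⟩
  choose msel hmsel using fun q : ℕ =>
    Finset.exists_max_image (Finset.range (N + 1)) (fun m : ℕ => |A.remainder q (m : ℝ)|) hne
  set Rstar : ℕ → ℝ := fun q => |A.remainder q (msel q : ℝ)| with hRstar
  have hRstar0 : ∀ q, 0 ≤ Rstar q := fun q => abs_nonneg _
  have hRle : ∀ q m : ℕ, m ≤ N → |A.remainder q (m : ℝ)| ≤ Rstar q := fun q m hm =>
    (hmsel q).2 m (Finset.mem_range.mpr (Nat.lt_succ_of_le hm))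
  have hA2 : ∑ q ∈ Ico 1 ⌈x ^ (1 - ε)⌉₊, Rstar q ≤ C₂ * Ax / L ^ (j + 3) := by
    have h := hx2 (fun q => (msel q : ℝ)) fun q =>
      (Nat.cast_le.mpr (Nat.lt_succ_iff.mp (Finset.mem_range.mp (hmsel q).1))).trans hNx
    rwa [Real.rpow_natCast] at h
  -- Step 1: `Σ₁` over `d` first
  have hSig : sigma1 A (j + 2) x y z = ∑ d ∈ M, (μ d : ℝ) * W d := by
    rw [sigma1_eq_sum_moebius_mul]
  -- Step 2: the sieve bound for each `d ∈ M`
  have hWd : ∀ {d : ℕ}, d ∈ M → |W d - A.density d * T d * V| ≤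
      CF * Real.exp (-s) * V * Ax * L ^ (j + 2) * |A.density d| +
        2 * L ^ (j + 2) * ∑ ν ∈ P.divisors.filter (fun ν : ℕ => (ν : ℝ) ≤ z ^ s),
          Rstar (d * ν) := by
    intro d hd
    obtain ⟨⟨hd1, hdy⟩, hdP⟩ := hmemM hd
    have hgd : 0 ≤ A.density d := hg d hd1
    obtain ⟨hw0, hwmono, -⟩ := hwprops hd1
    have h := weighted_sifted_sub_le hFL' A hK hw0 hgd hdP x (z ^ s) hz hzs
    have hexp : Real.exp (-(Real.log (z ^ s) / Real.log z)) = Real.exp (-s) := by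
      rw [Real.log_rpow hz0, mul_div_assoc, div_self hlogz.ne', mul_one]
    rw [hexp] at h
    -- the remainders
    have hrem : ∀ ν ∈ P.divisors.filter (fun ν : ℕ => (ν : ℝ) ≤ z ^ s),
        |(∑ n ∈ (Ioc 0 N).filter (fun n : ℕ => d * ν ∣ n), A.a n * w d n) -
            A.density (d * ν) * ∑ n ∈ Ioc 0 N, A.a n * w d n| ≤
          2 * L ^ (j + 2) * Rstar (d * ν) := by
      intro ν hν
      refine (abs_weighted_congrSum_sub_le A hsize hw0 hwmono (d * ν) N
        (fun m hm => hRle (d * ν) m hm)).trans ?_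
      calc 2 * Rstar (d * ν) * w d N ≤ 2 * Rstar (d * ν) * L ^ (j + 2) :=
            mul_le_mul_of_nonneg_left (hwN hd1) (mul_nonneg zero_le_two (hRstar0 _))
        _ = 2 * L ^ (j + 2) * Rstar (d * ν) := by ring
    have hmain : CF * (A.density d * T d) * V * Real.exp (-s) ≤
        CF * Real.exp (-s) * V * Ax * L ^ (j + 2) * |A.density d| := by
      rw [abs_of_nonneg hgd]
      have hT3 := (hTd hd).2.2
      calc CF * (A.density d * T d) * V * Real.exp (-s)
          = (CF * Real.exp (-s) * V * A.density d) * T d := by ring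
        _ ≤ (CF * Real.exp (-s) * V * A.density d) * (Ax * L ^ (j + 2)) :=
            mul_le_mul_of_nonneg_left hT3 (mul_nonneg (mul_nonneg (mul_nonneg hCF0.le
              (Real.exp_pos _).le) hV0) hgd)
        _ = CF * Real.exp (-s) * V * Ax * L ^ (j + 2) * A.density d := by ring
    calc |W d - A.density d * T d * V|
        ≤ CF * (A.density d * T d) * V * Real.exp (-s) +
            ∑ ν ∈ P.divisors.filter (fun ν : ℕ => (ν : ℝ) ≤ z ^ s),
              |(∑ n ∈ (Ioc 0 N).filter (fun n : ℕ => d * ν ∣ n), A.a n * w d n) -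
                  A.density (d * ν) * ∑ n ∈ Ioc 0 N, A.a n * w d n| := h
      _ ≤ CF * Real.exp (-s) * V * Ax * L ^ (j + 2) * |A.density d| +
            ∑ ν ∈ P.divisors.filter (fun ν : ℕ => (ν : ℝ) ≤ z ^ s),
              2 * L ^ (j + 2) * Rstar (d * ν) := add_le_add hmain (Finset.sum_le_sum hrem)
      _ = _ := by rw [Finset.mul_sum]
  -- Step 3: the term-by-term bound for `Σ₁ − H A(x) F`
  have hterm : ∀ d ∈ M,
      |(μ d : ℝ) * W d - H * Ax * (P₁ * ((μ d : ℝ) / d * Real.log (x / d) ^ (j + 2)))| ≤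
        CF * Real.exp (-s) * V * Ax * L ^ (j + 2) * |A.density d| +
          2 * L ^ (j + 2) * ∑ ν ∈ P.divisors.filter (fun ν : ℕ => (ν : ℝ) ≤ z ^ s),
            Rstar (d * ν) +
          (j + 2 : ℕ) * L ^ (j + 1) * I * V * |A.density d| +
          Ax * L ^ (j + 2) * |A.density d * V - H * P₁ / d| := by
    intro d hd
    obtain ⟨⟨hd1, hdy⟩, hdP⟩ := hmemM hd
    have hgd : 0 ≤ A.density d := hg d hd1
    have hd0 : (0 : ℝ) < d := by exact_mod_cast hd1
    have hdx : (d : ℝ) ≤ x := hdy.le.trans hyx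
    have hlxd : Real.log (x / d) ≤ L := by
      rw [Real.log_div hx0.ne' hd0.ne']
      linarith [Real.log_nonneg (show (1 : ℝ) ≤ d by exact_mod_cast hd1)]
    have hlxd0 : 0 ≤ Real.log (x / d) := Real.log_nonneg ((one_le_div hd0).mpr hdx)
    obtain ⟨hT1, hT2, -⟩ := hTd hd
    have hμ : |(μ d : ℝ)| ≤ 1 := by
      rw [← Int.cast_abs]
      exact_mod_cast ArithmeticFunction.abs_moebius_le_one
    have hid : (μ d : ℝ) * W d - H * Ax * (P₁ * ((μ d : ℝ) / d * Real.log (x / d) ^ (j + 2))) =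
        (μ d : ℝ) * ((W d - A.density d * T d * V) +
          A.density d * V * (T d - Ax * Real.log (x / d) ^ (j + 2)) +
          Ax * Real.log (x / d) ^ (j + 2) * (A.density d * V - H * P₁ / d)) := by ring
    rw [hid, abs_mul]
    refine (mul_le_of_le_one_left (abs_nonneg _) hμ).trans ?_
    refine (abs_add_three _ _ _).trans ?_
    have h2 : |A.density d * V * (T d - Ax * Real.log (x / d) ^ (j + 2))| ≤
        (j + 2 : ℕ) * L ^ (j + 1) * I * V * |A.density d| := by
      rw [abs_of_nonneg hgd, show A.density d * V * (T d - Ax * Real.log (x / d) ^ (j + 2)) =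
        -(A.density d * V * (Ax * Real.log (x / d) ^ (j + 2) - T d)) by ring, abs_neg,
        abs_of_nonneg (mul_nonneg (mul_nonneg hgd hV0) hT1)]
      calc A.density d * V * (Ax * Real.log (x / d) ^ (j + 2) - T d)
          ≤ A.density d * V * ((j + 2 : ℕ) * L ^ (j + 1) * I) :=
            mul_le_mul_of_nonneg_left hT2 (mul_nonneg hgd hV0)
        _ = (j + 2 : ℕ) * L ^ (j + 1) * I * V * A.density d := by ring
    have h3 : |Ax * Real.log (x / d) ^ (j + 2) * (A.density d * V - H * P₁ / d)| ≤
        Ax * L ^ (j + 2) * |A.density d * V - H * P₁ / d| := by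
      rw [abs_mul, abs_of_nonneg (mul_nonneg hAx0 (pow_nonneg hlxd0 _))]
      exact mul_le_mul_of_nonneg_right
        (mul_le_mul_of_nonneg_left (pow_le_pow_left₀ hlxd0 hlxd _) hAx0) (abs_nonneg _)
    linarith [hWd hd, h2, h3]
  -- Step 4: summing over `d ∈ M`
  have hF : H * Ax * mainTermF (j + 2) x y z =
      ∑ d ∈ M, H * Ax * (P₁ * ((μ d : ℝ) / d * Real.log (x / d) ^ (j + 2))) := by
    rw [mainTermF, ← hP₁, ← hP, ← hM, Finset.mul_sum, Finset.mul_sum]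
  have hRR : ∑ d ∈ M, ∑ ν ∈ P.divisors.filter (fun ν : ℕ => (ν : ℝ) ≤ z ^ s), Rstar (d * ν) ≤
      C₂ * Ax / L ^ (j + 3) := by
    have hM' : ∀ m ∈ M, m ≠ 0 ∧ m.Coprime P := fun m hm =>
      ⟨by have := (hmemM hm).1.1; omega, (hmemM hm).2⟩
    have hL' : ∀ m ∈ M, (m : ℝ) * z ^ s < x ^ (1 - ε) := by
      intro m hm
      have hmy := (hmemM hm).1.2
      calc (m : ℝ) * z ^ s < y * z ^ s := mul_lt_mul_of_pos_right hmy hzs0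
        _ = z ^ s * y := mul_comm _ _
        _ ≤ x ^ (1 - ε) := hlev
    exact (sum_coprime_sum_divisors_le (primesProdBelow_ne_zero z) Rstar hRstar0 M hM' (z ^ s)
      (x ^ (1 - ε)) hL').trans hA2
  have hsum : |sigma1 A (j + 2) x y z - H * Ax * mainTermF (j + 2) x y z| ≤
      CF * Real.exp (-s) * V * Ax * L ^ (j + 2) * (C₈' * L / Real.log z) +
        2 * L ^ (j + 2) * (C₂ * Ax / L ^ (j + 3)) +
        (j + 2 : ℕ) * L ^ (j + 1) * I * V * (C₈' * L / Real.log z) +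
        Ax * L ^ (j + 2) * (C₉' * z ^ (-η) * L / Real.log z) := by
    rw [hSig, hF, ← Finset.sum_sub_distrib]
    refine (Finset.abs_sum_le_sum_abs _ _).trans ?_
    refine (Finset.sum_le_sum hterm).trans ?_
    rw [Finset.sum_add_distrib, Finset.sum_add_distrib, Finset.sum_add_distrib,
      ← Finset.mul_sum, ← Finset.mul_sum, ← Finset.mul_sum, ← Finset.mul_sum]
    have hg_sum : ∑ d ∈ M, |A.density d| ≤ C₈' * L / Real.log z := hG
    have hc1 : 0 ≤ CF * Real.exp (-s) * V * Ax * L ^ (j + 2) :=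
      mul_nonneg (mul_nonneg (mul_nonneg (mul_nonneg hCF0.le (Real.exp_pos _).le) hV0) hAx0)
        (pow_nonneg hlx0.le _)
    have hc2 : 0 ≤ 2 * L ^ (j + 2) := mul_nonneg zero_le_two (pow_nonneg hlx0.le _)
    have hc3 : 0 ≤ (j + 2 : ℕ) * L ^ (j + 1) * I * V :=
      mul_nonneg (mul_nonneg (mul_nonneg (Nat.cast_nonneg _) (pow_nonneg hlx0.le _)) hI0) hV0
    have hc4 : 0 ≤ Ax * L ^ (j + 2) := mul_nonneg hAx0 (pow_nonneg hlx0.le _)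
    gcongr
  -- Step 5: the final shape
  have hQ1 : 1 ≤ L / Real.log z := by rwa [le_div_iff₀ hlogz, one_mul]
  have hQ : L / Real.log z ≤ (L / Real.log z) ^ 2 := le_self_pow₀ hQ1 two_ne_zero
  have hLj1 : 1 ≤ L ^ (j + 1) := one_le_pow₀ hlogx1
  have hes0 : 0 < Real.exp (-s) := Real.exp_pos _
  have hzη : 0 ≤ z ^ (-η) := Real.rpow_nonneg hz0.le _
  -- term 1
  have ht1 : CF * Real.exp (-s) * V * Ax * L ^ (j + 2) * (C₈' * L / Real.log z) ≤
      CF * C₇' * C₈' * (Real.exp (-s) * Ax * L ^ (j + 1)) * (L / Real.log z) ^ 2 := by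
    have hnn : 0 ≤ CF * Real.exp (-s) * Ax * L ^ (j + 2) * (C₈' * L / Real.log z) :=
      mul_nonneg (mul_nonneg (mul_nonneg (mul_nonneg hCF0.le hes0.le) hAx0)
        (pow_nonneg hlx0.le _)) (div_nonneg (mul_nonneg hC₈'0 hlx0.le) hlogz.le)
    calc CF * Real.exp (-s) * V * Ax * L ^ (j + 2) * (C₈' * L / Real.log z)
        = CF * Real.exp (-s) * Ax * L ^ (j + 2) * (C₈' * L / Real.log z) * V := by ring
      _ ≤ CF * Real.exp (-s) * Ax * L ^ (j + 2) * (C₈' * L / Real.log z) *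
            (C₇' / Real.log z) := mul_le_mul_of_nonneg_left hVle hnn
      _ = CF * C₇' * C₈' * (Real.exp (-s) * Ax * L ^ (j + 1)) * (L / Real.log z) ^ 2 := by
          field_simp
          ring
  -- term 2
  have ht2 : 2 * L ^ (j + 2) * (C₂ * Ax / L ^ (j + 3)) ≤
      1 * (Real.exp (-s) * Ax * L ^ (j + 1)) * (L / Real.log z) ^ 2 := by
    have h2C : 2 * C₂ ≤ L * Real.exp (-s) := by
      have h1 : 2 * C₂ * Real.exp s * Real.exp (-s) ≤ L * Real.exp (-s) :=
        mul_le_mul_of_nonneg_right hC₂log hes0.le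
      rwa [mul_assoc, ← Real.exp_add, add_neg_cancel, Real.exp_zero, mul_one] at h1
    have hLpow : L ^ (j + 3) = L ^ (j + 2) * L := by ring
    calc 2 * L ^ (j + 2) * (C₂ * Ax / L ^ (j + 3))
        = (2 * C₂) * Ax / L := by
          rw [hLpow]
          field_simp
      _ ≤ (L * Real.exp (-s)) * Ax / L :=
          div_le_div_of_nonneg_right (mul_le_mul_of_nonneg_right h2C hAx0) hlx0.le
      _ = Real.exp (-s) * Ax := by field_simp
      _ ≤ Real.exp (-s) * Ax * L ^ (j + 1) := le_mul_of_one_le_right (mul_nonneg hes0.le hAx0) hLj1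
      _ ≤ Real.exp (-s) * Ax * L ^ (j + 1) * (L / Real.log z) ^ 2 :=
          le_mul_of_one_le_right (mul_nonneg (mul_nonneg hes0.le hAx0) (zero_le_one.trans hLj1))
            (one_le_pow₀ hQ1)
      _ = 1 * (Real.exp (-s) * Ax * L ^ (j + 1)) * (L / Real.log z) ^ 2 := by ring
  -- term 3
  have ht3 : (j + 2 : ℕ) * L ^ (j + 1) * I * V * (C₈' * L / Real.log z) ≤
      (j + 2 : ℕ) * C₇' * C₈' * (I * L ^ j) * (L / Real.log z) ^ 2 := by
    have hnn : 0 ≤ (j + 2 : ℕ) * L ^ (j + 1) * I * (C₈' * L / Real.log z) :=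
      mul_nonneg (mul_nonneg (mul_nonneg (Nat.cast_nonneg _) (pow_nonneg hlx0.le _)) hI0)
        (div_nonneg (mul_nonneg hC₈'0 hlx0.le) hlogz.le)
    calc (j + 2 : ℕ) * L ^ (j + 1) * I * V * (C₈' * L / Real.log z)
        = (j + 2 : ℕ) * L ^ (j + 1) * I * (C₈' * L / Real.log z) * V := by ring
      _ ≤ (j + 2 : ℕ) * L ^ (j + 1) * I * (C₈' * L / Real.log z) * (C₇' / Real.log z) :=
          mul_le_mul_of_nonneg_left hVle hnn
      _ = (j + 2 : ℕ) * C₇' * C₈' * (I * L ^ j) * (L / Real.log z) ^ 2 := by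
          field_simp
          ring
  -- term 4
  have ht4 : Ax * L ^ (j + 2) * (C₉' * z ^ (-η) * L / Real.log z) ≤
      C₉' * (z ^ (-η) * Ax * L ^ (j + 2)) * (L / Real.log z) ^ 2 := by
    calc Ax * L ^ (j + 2) * (C₉' * z ^ (-η) * L / Real.log z)
        = C₉' * (z ^ (-η) * Ax * L ^ (j + 2)) * (L / Real.log z) := by ring
      _ ≤ C₉' * (z ^ (-η) * Ax * L ^ (j + 2)) * (L / Real.log z) ^ 2 :=
          mul_le_mul_of_nonneg_left hQ (mul_nonneg hC₉'0 (mul_nonneg (mul_nonneg hzη hAx0)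
            (pow_nonneg hlx0.le _)))
  -- conclusion
  rw [hIeq]
  push_cast at ht3 hsum ⊢
  have hQ0 : 0 ≤ (L / Real.log z) ^ 2 := sq_nonneg _
  have hE₁0 : 0 ≤ Real.exp (-s) * Ax * L ^ (j + 1) :=
    mul_nonneg (mul_nonneg hes0.le hAx0) (pow_nonneg hlx0.le _)
  have hE₂0 : 0 ≤ I * L ^ j := mul_nonneg hI0 (pow_nonneg hlx0.le _)
  have hE₃0 : 0 ≤ z ^ (-η) * Ax * L ^ (j + 2) :=
    mul_nonneg (mul_nonneg hzη hAx0) (pow_nonneg hlx0.le _)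
  have ha0 : 0 ≤ CF * C₇' * C₈' := mul_nonneg (mul_nonneg hCF0.le hC₇'0) hC₈'0
  have hb0 : 0 ≤ ((j : ℝ) + 2) * C₇' * C₈' := mul_nonneg (mul_nonneg (by positivity) hC₇'0) hC₈'0
  have h4 := hsum.trans (add_le_add (add_le_add (add_le_add ht1 ht2) ht3) ht4)
  clear ht1 ht2 ht3 ht4 hsum hterm hWd hF hRR hSig hTd hwN hwprops hA2 hRle hmsel
  generalize (L / Real.log z) ^ 2 = Q at hQ0 h4 ⊢
  generalize Real.exp (-s) * Ax * L ^ (j + 1) = E₁ at hE₁0 h4 ⊢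
  generalize I * L ^ j = E₂ at hE₂0 h4 ⊢
  generalize z ^ (-η) * Ax * L ^ (j + 2) = E₃ at hE₃0 h4 ⊢
  generalize CF * C₇' * C₈' = a at ha0 h4 ⊢
  generalize ((j : ℝ) + 2) * C₇' * C₈' = b at hb0 h4 ⊢
  have hid : (a + 1 + b + C₉') * (E₁ + E₂ + E₃) * Q -
      (a * E₁ * Q + 1 * E₁ * Q + b * E₂ * Q + C₉' * E₃ * Q) =
      Q * (a * (E₂ + E₃) + (E₂ + E₃) + b * (E₁ + E₃) + C₉' * (E₁ + E₂)) := by ring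
  have h0 : 0 ≤ Q * (a * (E₂ + E₃) + (E₂ + E₃) + b * (E₁ + E₃) + C₉' * (E₁ + E₂)) :=
    mul_nonneg hQ0 (add_nonneg (add_nonneg (add_nonneg (mul_nonneg ha0 (add_nonneg hE₂0 hE₃0))
      (add_nonneg hE₂0 hE₃0)) (mul_nonneg hb0 (add_nonneg hE₁0 hE₃0)))
      (mul_nonneg hC₉'0 (add_nonneg hE₁0 hE₂0)))
  linarith only [h4, hid, h0]

namespace SigmaZero

/-! ### [FriedlanderIwaniecPisa1978] Lemma 10 with the (A₂)-input displayed -/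

/-- **(A₃) made pointwise for all `d ≤ ⌊x⌋`** (a copy of the tree's
`BombieriSieve.SigmaZero.remainder_pointwise` assuming only the normalisation `A(x) = ∑_{n ≤ x} a_n`
and (A₃) instead of the bundle (A₁)–(A₅)): there are `E₀ ≥ 0` and `c₁ > 0` with, for all large `x`
and all `1 ≤ d ≤ ⌊x⌋`, `|R(x; d)| ≤ E₀ d^{−3/4} A(x) (1 + log x)^{c₁}` ((A₃) applied at
`x̂ = ⌊x⌋ + ½`, where `R(x̂; d) = R(x; d)`, `A(x̂) = A(x)`, `d ≤ ⌊x⌋ < x̂`; `F(d) ≪ d^{1/4}`).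
[cite: BombieriRIMS1977, p. 3 (A₃)] -/
theorem remainder_pointwise_of_bombieriA3 (A : SieveSequence)
    (hsize : ∀ x, A.size x = A.congrSum 1 x) (h3 : A.BombieriA3) :
    ∃ E₀ c₁ : ℝ, 0 ≤ E₀ ∧ 0 < c₁ ∧ ∀ᶠ x : ℝ in atTop, ∀ d : ℕ, 1 ≤ d → d ≤ ⌊x⌋₊ →
      |A.remainder d x| ≤
        E₀ * (d : ℝ) ^ (-(3 / 4) : ℝ) * A.size x * (1 + Real.log x) ^ c₁ := by
  obtain ⟨F, c₁, c₂, hc₁, -, hF, -, C₃, hev⟩ := h3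
  obtain ⟨CF, hCF⟩ := hF (1 / 4) (by norm_num)
  obtain ⟨X₀, hX₀⟩ := Filter.eventually_atTop.mp hev
  refine ⟨|C₃| * max CF 0, c₁, by positivity, hc₁, ?_⟩
  filter_upwards [eventually_ge_atTop (max X₀ 1 + 1)] with x hx d hd1 hdN
  set xh : ℝ := ((⌊x⌋₊ : ℕ) : ℝ) + 1 / 2 with hxh
  have hx1 : 1 ≤ x := by linarith [le_max_right X₀ 1]
  have hx0 : 0 ≤ x := by linarith
  have hfloor : x < (⌊x⌋₊ : ℝ) + 1 := Nat.lt_floor_add_one x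
  have hxhX₀ : X₀ ≤ xh := by rw [hxh]; linarith [le_max_left X₀ 1]
  have hdxh : (d : ℝ) < xh := by
    rw [hxh]; have : (d : ℝ) ≤ ⌊x⌋₊ := by exact_mod_cast hdN
    linarith
  have hR := hX₀ xh hxhX₀ d hd1 hdxh
  -- `R(xh; d) = R(x; d)`, `A(xh) = A(x)`
  have hsz : A.size xh = A.size x := by rw [hsize, hsize, hxh, congrSum_floor_add_half]
  have hrem : A.remainder d xh = A.remainder d x := by
    rw [SieveSequence.remainder, SieveSequence.remainder, hxh, congrSum_floor_add_half, ← hxh, hsz]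
  rw [hrem, hsz] at hR
  have hX : 0 ≤ A.size x := SieveSequence.size_nonneg_of_size_eq hsize x
  have hd0 : (0 : ℝ) < d := by exact_mod_cast hd1
  -- `log xh ≤ 1 + log x`
  have hfl1 : (1 : ℝ) ≤ ⌊x⌋₊ := by exact_mod_cast Nat.le_floor (by exact_mod_cast hx1)
  have hxh1 : 1 ≤ xh := by rw [hxh]; linarith
  have hlogxh : Real.log xh ≤ 1 + Real.log x := by
    have hxh2 : xh ≤ 2 * x := by rw [hxh]; linarith [Nat.floor_le hx0]
    calc Real.log xh ≤ Real.log (2 * x) := Real.log_le_log (by linarith) hxh2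
      _ = Real.log 2 + Real.log x := Real.log_mul two_ne_zero (by linarith)
      _ ≤ 1 + Real.log x := by
          have : Real.log 2 ≤ 1 := by have := Real.log_two_lt_d9; norm_num at this; linarith
          linarith
  have hlogxh0 : 0 ≤ Real.log xh := Real.log_nonneg hxh1
  have hpowlog : Real.log xh ^ c₁ ≤ (1 + Real.log x) ^ c₁ :=
    Real.rpow_le_rpow hlogxh0 hlogxh hc₁.le
  -- `F d / d ≤ CF d^{1/4} / d = CF d^{-3/4}`
  have hFd : |F d| ≤ max CF 0 * (d : ℝ) ^ (1 / 4 : ℝ) :=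
    (hCF d hd1).trans (mul_le_mul_of_nonneg_right (le_max_left _ _) (Real.rpow_nonneg hd0.le _))
  have hFdd : |F d / d| ≤ max CF 0 * (d : ℝ) ^ (-(3 / 4) : ℝ) := by
    rw [abs_div, abs_of_pos hd0, div_le_iff₀ hd0]
    calc |F d| ≤ max CF 0 * (d : ℝ) ^ (1 / 4 : ℝ) := hFd
      _ = max CF 0 * (d : ℝ) ^ (-(3 / 4) : ℝ) * d := by
          rw [mul_assoc, ← Real.rpow_add_one hd0.ne']; norm_num
  calc |A.remainder d x| ≤ C₃ * (F d / d) * A.size x * Real.log xh ^ c₁ := hR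
    _ ≤ |C₃ * (F d / d) * A.size x * Real.log xh ^ c₁| := le_abs_self _
    _ = |C₃| * |F d / d| * A.size x * Real.log xh ^ c₁ := by
        rw [abs_mul, abs_mul, abs_mul, abs_of_nonneg hX, abs_of_nonneg (Real.rpow_nonneg hlogxh0 _)]
    _ ≤ |C₃| * (max CF 0 * (d : ℝ) ^ (-(3 / 4) : ℝ)) * A.size x * (1 + Real.log x) ^ c₁ := by
        gcongr
    _ = |C₃| * max CF 0 * (d : ℝ) ^ (-(3 / 4) : ℝ) * A.size x * (1 + Real.log x) ^ c₁ := by ring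

set_option maxHeartbeats 1600000 in
/-- **[FriedlanderIwaniecPisa1978] Lemma 10 at a finite level** (p. 738: "For fixed `(k)`,
`Σ₀ ≪ A(x)(log x)^{|k|−2} log z + o(A(x)(log x)^{|k|−1})`"; there attributed to Lemmata 1–2 of
Bombieri's *The asymptotic sieve* [BombieriAsymptoticSieve1976], "this proof can also be simplified
by means of the fundamental lemma"), scalar `k ≥ 2`, `2 ≤ z ≤ x^{1/4}`, for a sequence with
`A(x) = ∑_{n ≤ x} a_n`, (A₁), (A₃), (A₄), (A₅) and `g ≥ 0`, the single use of (A₂) in the tree's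
proof `BombieriSieve.SigmaZero.sigma0_bound_of_density_nonneg` (level `x^{1−1/(5k)}`, `B = 2k + 1`,
for the moduli `d₁ν ≤ x^{1−1/(2k)} x^{1/(4k)}` of bin G and the prime powers `q^c < x^{1−1/(5k)}` of
bin S) being replaced by its output at the point `x`: there is `C` such that for every `δ > 0` and
every `C_{A2}`, for all large `x`, IF
`∑_{d < x^{1−1/(5k)}} |R(y_d; d)| ≤ C_{A2} A(x)(log x)^{−(2k+1)}` for all selections `y_d ≤ x`, THEN
`Σ₀ ≤ C A(x)(log x)^{k−2} log z + δ A(x)(log x)^{k−1}` for all `2 ≤ z ≤ x^{1/4}`. The proof is that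
of `sigma0_bound_of_density_nonneg` verbatim (bins A, S, G; `binA_sum_le`, `binS_mass_le'`,
`binG_sum_le`, `sum_remSum_le`, `lamG_le`, `lamGz_le_all`, Lemma 7), the (A₂)-constant entering only
the threshold `x₀(δ, C_{A2})`. [cite: FriedlanderIwaniecPisa1978, Lemma 10] -/
theorem sigma0_bound_finiteLevel (A : SieveSequence) (hsize : ∀ x, A.size x = A.congrSum 1 x)
    (h1 : A.BombieriA1) (h3 : A.BombieriA3) (h4 : A.BombieriA4) (h5 : A.BombieriA5)
    (hg0 : ∀ d : ℕ, 1 ≤ d → 0 ≤ A.density d) {k : ℕ} (hk : 2 ≤ k) :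
    ∃ C : ℝ, ∀ δ : ℝ, 0 < δ → ∀ CA2 : ℝ, ∀ᶠ x : ℝ in atTop,
      (∀ y : ℕ → ℝ, (∀ d, y d ≤ x) →
        ∑ d ∈ Ico 1 ⌈x ^ (1 - 1 / (5 * (k : ℝ)))⌉₊, |A.remainder d (y d)| ≤
          CA2 * A.size x / Real.log x ^ ((2 * k + 1 : ℕ) : ℝ)) →
      ∀ z : ℝ, 2 ≤ z → z ≤ x ^ (1 / 4 : ℝ) →
      sigma0 A k x z ≤
        C * A.size x * Real.log x ^ (k - 2) * Real.log z + δ * A.size x * Real.log x ^ (k - 1) := by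
  classical
  have hg1 : ∀ p : ℕ, p.Prime → A.density p < 1 := fun p hp => h1.2 p hp.one_lt
  have hXnn : ∀ x, 0 ≤ A.size x := SieveSequence.size_nonneg_of_size_eq hsize
  have hk1 : 1 ≤ k := by omega
  have hkR : (2 : ℝ) ≤ k := by exact_mod_cast hk
  have hkpos : (0 : ℝ) < k := by linarith
  -- sieve dimension and Lemma 7
  obtain ⟨K, hdim⟩ := hasSieveDimension_of_A1_A5 A h1 h5 hg0
  have hK1 : 1 ≤ K := hdim.one_le
  set K₁ : ℝ := 1 + 2 * K ^ (10 : ℕ) with hK₁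
  have hK₁0 : 0 ≤ K₁ := by positivity
  obtain ⟨H, -, -, η, -, C₇, hC₇⟩ := FI1978_lemma7_of_A1_A5 A h1 h5
  set C₇' : ℝ := max C₇ 0 with hC₇'
  have hC₇'0 : 0 ≤ C₇' := le_max_right _ _
  -- the families of constants for the main-term sums
  obtain ⟨Cg, hCg0, hCg⟩ := lamG_le A h1 h5 hg0 (k - 1)
  obtain ⟨Cgz, hCgz0, hCgz⟩ := lamGz_le_all A h1 h5 hg0 (k - 1)
  set Call : ℝ := ∑ j ∈ range k, (k.choose j : ℝ) * Cg j with hCall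
  set Cz : ℝ := ∑ j ∈ range k, (k.choose j : ℝ) * Cgz j with hCz
  have hCall0 : 0 ≤ Call := Finset.sum_nonneg fun j _ => mul_nonneg (Nat.cast_nonneg _) (hCg0 j)
  have hCz0 : 0 ≤ Cz := Finset.sum_nonneg fun j _ => mul_nonneg (Nat.cast_nonneg _) (hCgz0 j)
  -- parameters
  set θ : ℝ := 1 / (40 * k) with hθ
  have hθ0 : 0 < θ := by positivity
  have hθ1 : θ ≤ 1 := by
    rw [hθ, div_le_one (by positivity)]; linarith
  have hθ2k : θ ≤ 1 / (2 * k) := one_div_le_one_div_of_le (by positivity) (by linarith)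
  set ε₁ : ℝ := 1 / (5 * k) with hε₁
  have hε₁0 : 0 < ε₁ := by positivity
  have hε₁le : ε₁ ≤ 1 / 10 := one_div_le_one_div_of_le (by norm_num) (by linarith)
  set a : ℝ := 3 / 4 * (1 - ε₁) - 1 / 2 with ha
  have ha0 : 0 < a := by rw [ha]; linarith
  -- the final constant
  set Cfin : ℝ := K₁ * C₇' * (Cz + Call) * (2 : ℝ) ^ k / θ ^ 2 with hCfin
  refine ⟨Cfin, fun δ hδ CA2 => ?_⟩
  set CA2' : ℝ := max CA2 0 with hCA2'
  have hCA2'0 : 0 ≤ CA2' := le_max_right _ _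
  -- (A₃) pointwise, (A₁) decay
  obtain ⟨E₀, c₁, hE₀, hc₁, hA3⟩ := remainder_pointwise_of_bombieriA3 A hsize h3
  obtain ⟨C₁, hC₁0, hC₁⟩ := abs_density_le_rpow78 A h1
  have hZs : Summable (fun n : ℕ => ((n : ℝ) ^ (3 / 2 : ℝ))⁻¹) :=
    Real.summable_nat_rpow_inv.mpr (by norm_num)
  set Z : ℝ := (5 / 2) * ∑' n : ℕ, ((n : ℝ) ^ (3 / 2 : ℝ))⁻¹ with hZ
  have hZ0 : 0 ≤ Z := mul_nonneg (by norm_num) (tsum_nonneg fun n => by positivity)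
  -- the constant of the remainder term of bin G
  set CR : ℝ := (2 : ℝ) ^ k * (2 : ℝ) ^ k * (k * (3 : ℝ) ^ (k - 1)) * CA2' with hCR
  -- eventual conditions
  have hA4 := h4.2.def (show (0 : ℝ) < δ / 4 by positivity)
  have hw2ev : ∀ᶠ x : ℝ in atTop, 2 ≤ x ^ θ := (tendsto_rpow_atTop hθ0).eventually_ge_atTop 2
  have hE5 := eventually_logpow_rpow_le 1 le_rfl (show (0 : ℝ) < 1 / (16 * k) by positivity)
    (show (0 : ℝ) < δ / (12 * (C₁ * Z + 1)) by positivity)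
  have hE6 := eventually_const_le_logpow CA2' (show (0 : ℝ) < δ / 12 by positivity)
    (show 1 ≤ 2 * k by omega)
  have hE7 := eventually_logpow_rpow_le 2 hc₁.le ha0
    (show (0 : ℝ) < δ / (12 * (6 * E₀ + 1)) by positivity)
  have hE8 := eventually_const_le_logpow CR (show (0 : ℝ) < δ / 4 by positivity)
    (show 1 ≤ k + 1 by omega)
  filter_upwards [eventually_ge_atTop (Real.exp 1), hw2ev, hA3, hA4, hE5, hE6, hE7, hE8]
    with x hxe hw2 hA3x hA4x hE5x hE6x hE7x hE8x hA2x z hz2 _hzx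
  -- basic facts about `x`
  have hx1 : 1 < x := lt_of_lt_of_le (by have := Real.exp_one_gt_d9; linarith) hxe
  have hx1' : 1 ≤ x := hx1.le
  have hx0 : 0 < x := by linarith
  set Lx := Real.log x with hLx
  have hLx1 : 1 ≤ Lx := by rw [hLx, ← Real.log_exp 1]; exact Real.log_le_log (Real.exp_pos 1) hxe
  have hLx0 : 0 < Lx := by linarith
  have h1Lx : 1 + Lx ≤ 2 * Lx := by linarith
  set X := A.size x with hXdef
  have hX : 0 ≤ X := hXnn x
  have hlogz : 0 ≤ Real.log z := Real.log_nonneg (by linarith)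
  -- parameters at `x`
  set w : ℝ := x ^ θ with hw
  set Y : ℝ := x ^ (1 / (2 * (k : ℝ))) with hY
  set L : ℝ := x ^ (1 - ε₁) with hL
  have hw1 : 1 ≤ w := by linarith
  have hwY : w ≤ Y := Real.rpow_le_rpow_of_exponent_le hx1' hθ2k
  have hY1 : 1 ≤ Y := hw1.trans hwY
  have hY0 : 0 < Y := by linarith
  have hYk : Y ^ k = Real.sqrt x := by
    rw [hY, ← Real.rpow_natCast, ← Real.rpow_mul hx0.le, Real.sqrt_eq_rpow]
    congr 1; field_simp
  have hlogw : Real.log w = θ * Lx := by rw [hw, Real.log_rpow hx0]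
  have hlogw0 : 0 < Real.log w := by rw [hlogw]; positivity
  have hL0 : 0 < L := Real.rpow_pos_of_pos hx0 _
  have hL1 : 1 ≤ L := Real.one_le_rpow hx1' (by linarith)
  have hLx' : L ≤ x := by
    conv_rhs => rw [← Real.rpow_one x]
    exact Real.rpow_le_rpow_of_exponent_le hx1' (by linarith)
  have hxY : x / Y = x ^ (1 - 1 / (2 * (k : ℝ))) := by
    rw [hY, Real.rpow_sub hx0, Real.rpow_one]
  have hxY1 : 1 ≤ x / Y := by rw [hxY]; exact Real.one_le_rpow hx1' (by
    have : 1 / (2 * (k : ℝ)) ≤ 1 / 4 := one_div_le_one_div_of_le (by norm_num) (by linarith)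
    linarith)
  have hxYx : x / Y ≤ x := div_le_self hx0.le hY1
  have hw10 : w ^ (10 : ℕ) = x ^ (10 * θ) := by
    rw [hw, ← Real.rpow_natCast, ← Real.rpow_mul hx0.le, mul_comm]; norm_num
  have hlevel : x / Y * w ^ (10 : ℕ) < L := by
    rw [hxY, hw10, ← Real.rpow_add hx0, hL, Real.rpow_lt_rpow_left_iff hx1]
    exact level_exponent_lt hkpos
  -- Lemma 7 at `w`
  have hVw : A.densityProduct (primesProdBelow w) ≤ C₇' / (θ * Lx) := by
    rw [← hlogw]
    exact ((hC₇ w hw2).2).trans (div_le_div_of_nonneg_right (le_max_left _ _) hlogw0.le)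
  have hVw0 : 0 ≤ A.densityProduct (primesProdBelow w) :=
    Finset.prod_nonneg fun p hp => (sub_pos.mpr (hg1 p (Nat.prime_of_mem_primeFactors hp))).le
  -- the (A₂)-input: the remainder sum over `r < L`
  have hRA2 : ∑ r ∈ Ico 1 ⌈L⌉₊, |A.remainder r x| ≤ CA2' * X / Lx ^ (2 * k + 1) := by
    have h := hA2x (fun _ => x) (fun _ => le_rfl)
    rw [Real.rpow_natCast] at h
    refine h.trans ?_
    gcongr
    exact le_max_left _ _
  -------------------------------------------------
  -- Bin A
  -------------------------------------------------
  have hSA : ∑ n ∈ binA x z, generalizedVonMangoldt k n * A.a n ≤ δ / 4 * X * Lx ^ (k - 1) := by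
    refine (binA_sum_le A hk1 hx1' z).trans ?_
    rw [← hsize]
    have h := hA4x
    rw [Real.norm_of_nonneg (hXnn _), Real.norm_of_nonneg (div_nonneg hX hLx0.le)] at h
    calc Lx ^ k * A.size (Real.sqrt x) ≤ Lx ^ k * (δ / 4 * (X / Lx)) :=
          mul_le_mul_of_nonneg_left h (pow_nonneg hLx0.le k)
      _ = δ / 4 * X * (Lx ^ k / Lx) := by ring
      _ = δ / 4 * X * Lx ^ (k - 1) := by
          rw [show Lx ^ k = Lx ^ (k - 1) * Lx by rw [← pow_succ, Nat.sub_add_cancel hk1],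
            mul_div_cancel_right₀ _ hLx0.ne']
  -------------------------------------------------
  -- Bin S
  -------------------------------------------------
  have hSS : ∑ n ∈ binS x z Y, generalizedVonMangoldt k n * A.a n ≤ δ / 4 * X * Lx ^ (k - 1) := by
    -- `Λ_k(n) ≤ (log x)^k`
    have hstep : ∑ n ∈ binS x z Y, generalizedVonMangoldt k n * A.a n ≤
        Lx ^ k * ∑ n ∈ binS x z Y, A.a n := by
      rw [Finset.mul_sum]
      refine Finset.sum_le_sum fun n hn => ?_
      obtain ⟨hn, -⟩ := Finset.mem_filter.mp hn
      obtain ⟨hn, -⟩ := Finset.mem_filter.mp hn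
      obtain ⟨⟨hn0, hnx⟩, -⟩ := mem_sigma0Set.mp hn
      have hn1 : (1 : ℝ) ≤ n := by exact_mod_cast hn0
      have hnx' : (n : ℝ) ≤ x := le_trans (by exact_mod_cast hnx) (Nat.floor_le hx0.le)
      refine mul_le_mul_of_nonneg_right ((generalizedVonMangoldt_le hk1 n).trans ?_) (A.a_nonneg n)
      exact pow_le_pow_left₀ (Real.log_nonneg hn1) (Real.log_le_log (by linarith) hnx') k
    refine hstep.trans ?_
    -- the pointwise (A₃) bound in the form needed
    set E : ℝ := E₀ * X * (1 + Lx) ^ c₁ with hE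
    have hE0' : 0 ≤ E := by positivity
    have hR : ∀ d : ℕ, 1 ≤ d → d ≤ ⌊x⌋₊ → |A.remainder d x| ≤ E * (d : ℝ) ^ (-(3 / 4) : ℝ) := by
      intro d hd hdN
      calc |A.remainder d x| ≤ E₀ * (d : ℝ) ^ (-(3 / 4) : ℝ) * X * (1 + Lx) ^ c₁ := hA3x d hd hdN
        _ = E * (d : ℝ) ^ (-(3 / 4) : ℝ) := by rw [hE]; ring
    have hmass := binS_mass_le' A (z := z) hX hY0 hL0 hE0' hC₁0 hC₁ hR
    -- (a) the density part
    have hYpow : Y ^ (-(1 / 8) : ℝ) = x ^ (-(1 / (16 * (k : ℝ)))) := by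
      rw [hY, ← Real.rpow_mul hx0.le]; congr 1; field_simp; ring
    have ha' : Lx ^ k * (C₁ * Y ^ (-(1 / 8) : ℝ) * Z * X) ≤ δ / 12 * X * Lx ^ (k - 1) := by
      have h := hE5x
      rw [Real.rpow_zero, mul_one, pow_one] at h
      -- `Lx x^{-1/(16k)} ≤ δ/(12 (C₁ Z + 1))`
      have hsplit : Lx ^ k = Lx ^ (k - 1) * Lx := by rw [← pow_succ, Nat.sub_add_cancel hk1]
      rw [hYpow, hsplit]
      have hCZ : C₁ * Z * (δ / (12 * (C₁ * Z + 1))) ≤ δ / 12 := by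
        rw [mul_div_assoc', div_le_div_iff₀ (by positivity) (by norm_num)]
        have hCZ0 : 0 ≤ C₁ * Z := mul_nonneg hC₁0 hZ0
        have : C₁ * Z * δ * 12 = δ * (12 * (C₁ * Z)) := by ring
        rw [this]
        exact mul_le_mul_of_nonneg_left (by linarith) hδ.le
      calc Lx ^ (k - 1) * Lx * (C₁ * x ^ (-(1 / (16 * (k : ℝ)))) * Z * X)
          = Lx ^ (k - 1) * X * (C₁ * Z * (Lx * x ^ (-(1 / (16 * (k : ℝ)))))) := by ring
        _ ≤ Lx ^ (k - 1) * X * (C₁ * Z * (δ / (12 * (C₁ * Z + 1)))) := by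
            gcongr
        _ ≤ Lx ^ (k - 1) * X * (δ / 12) := by gcongr
        _ = δ / 12 * X * Lx ^ (k - 1) := by ring
    -- (b) the (A₂) part
    have hLxne : Lx ≠ 0 := hLx0.ne'
    have hb' : Lx ^ k * (CA2' * X / Lx ^ (2 * k + 1)) ≤ δ / 12 * X * Lx ^ (k - 1) := by
      have e1 : Lx ^ (2 * k + 1) = Lx ^ k * Lx ^ (k + 1) := by rw [← pow_add]; congr 1; omega
      have e2 : Lx ^ (2 * k) = Lx ^ (k - 1) * Lx ^ (k + 1) := by rw [← pow_add]; congr 1; omega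
      have hk1p : 0 < Lx ^ (k + 1) := pow_pos hLx0 _
      calc Lx ^ k * (CA2' * X / Lx ^ (2 * k + 1)) = CA2' * X / Lx ^ (k + 1) := by
            rw [e1]; field_simp
        _ ≤ (δ / 12 * Lx ^ (2 * k)) * X / Lx ^ (k + 1) := by gcongr
        _ = δ / 12 * X * Lx ^ (k - 1) := by rw [e2]; field_simp
    -- (c) the large-moduli part
    have hc' : Lx ^ k * ((bigSqIdx x Y).card * (E * L ^ (-(3 / 4) : ℝ))) ≤
        δ / 12 * X * Lx ^ (k - 1) := by
      have hcard : ((bigSqIdx x Y).card : ℝ) ≤ 6 * x ^ (1 / 2 : ℝ) * Lx := by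
        refine (card_bigSqIdx_le hx1' Y).trans ?_
        have hsx : 1 ≤ Real.sqrt x := by rw [Real.sqrt_eq_rpow]; exact Real.one_le_rpow hx1' (by norm_num)
        have hl2 : Lx / Real.log 2 ≤ 2 * Lx := by
          calc Lx / Real.log 2 ≤ Lx / (1 / 2) := div_le_div_of_nonneg_left hLx0.le (by norm_num)
                (by have := Real.log_two_gt_d9; linarith)
            _ = 2 * Lx := by ring
        rw [← Real.sqrt_eq_rpow]
        calc (Real.sqrt x + 1) * (Lx / Real.log 2 + 1) ≤ (2 * Real.sqrt x) * (3 * Lx) :=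
              mul_le_mul (by linarith) (by linarith) (by positivity) (by positivity)
          _ = 6 * Real.sqrt x * Lx := by ring
      have hLpow : L ^ (-(3 / 4) : ℝ) = x ^ (-(3 / 4 * (1 - ε₁))) := by
        rw [hL, ← Real.rpow_mul hx0.le]; congr 1; ring
      have hxpow : x ^ (1 / 2 : ℝ) * x ^ (-(3 / 4 * (1 - ε₁))) = x ^ (-a) := by
        rw [← Real.rpow_add hx0]; congr 1; rw [ha]; ring
      have h7 := hE7x
      have hsplit : Lx ^ k = Lx ^ (k - 1) * Lx := by rw [← pow_succ, Nat.sub_add_cancel hk1]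
      have hE6' : 6 * E₀ * (δ / (12 * (6 * E₀ + 1))) ≤ δ / 12 := by
        rw [mul_div_assoc', div_le_div_iff₀ (by positivity) (by norm_num)]
        have : 6 * E₀ * δ * 12 = δ * (12 * (6 * E₀)) := by ring
        rw [this]
        exact mul_le_mul_of_nonneg_left (by linarith) hδ.le
      calc Lx ^ k * ((bigSqIdx x Y).card * (E * L ^ (-(3 / 4) : ℝ)))
          ≤ Lx ^ k * ((6 * x ^ (1 / 2 : ℝ) * Lx) * (E * L ^ (-(3 / 4) : ℝ))) := by
            gcongr
        _ = Lx ^ (k - 1) * X * (6 * E₀) *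
              (Lx ^ 2 * (1 + Lx) ^ c₁ * (x ^ (1 / 2 : ℝ) * x ^ (-(3 / 4 * (1 - ε₁))))) := by
            rw [hsplit, hLpow, hE]; try ring
        _ = Lx ^ (k - 1) * X * (6 * E₀) * (Lx ^ 2 * (1 + Lx) ^ c₁ * x ^ (-a)) := by rw [hxpow]
        _ ≤ Lx ^ (k - 1) * X * (6 * E₀) * (δ / (12 * (6 * E₀ + 1))) := by gcongr
        _ = Lx ^ (k - 1) * X * (6 * E₀ * (δ / (12 * (6 * E₀ + 1)))) := by ring
        _ ≤ Lx ^ (k - 1) * X * (δ / 12) := by gcongr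
        _ = δ / 12 * X * Lx ^ (k - 1) := by ring
    calc Lx ^ k * ∑ n ∈ binS x z Y, A.a n
        ≤ Lx ^ k * (C₁ * Y ^ (-(1 / 8) : ℝ) * Z * X + ∑ r ∈ Ico 1 ⌈L⌉₊, |A.remainder r x| +
            (bigSqIdx x Y).card * (E * L ^ (-(3 / 4) : ℝ))) :=
          mul_le_mul_of_nonneg_left hmass (pow_nonneg hLx0.le k)
      _ ≤ Lx ^ k * (C₁ * Y ^ (-(1 / 8) : ℝ) * Z * X + CA2' * X / Lx ^ (2 * k + 1) +
            (bigSqIdx x Y).card * (E * L ^ (-(3 / 4) : ℝ))) := by gcongr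
      _ = Lx ^ k * (C₁ * Y ^ (-(1 / 8) : ℝ) * Z * X) + Lx ^ k * (CA2' * X / Lx ^ (2 * k + 1)) +
            Lx ^ k * ((bigSqIdx x Y).card * (E * L ^ (-(3 / 4) : ℝ))) := by ring
      _ ≤ δ / 12 * X * Lx ^ (k - 1) + δ / 12 * X * Lx ^ (k - 1) + δ / 12 * X * Lx ^ (k - 1) :=
          add_le_add (add_le_add ha' hb') hc'
      _ = δ / 4 * X * Lx ^ (k - 1) := by ring
  -------------------------------------------------
  -- Bin G: the remainder term
  -------------------------------------------------
  have hREM : ∀ (cond : ℕ → Prop) [DecidablePred cond],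
      (2 : ℝ) ^ k * (1 + Lx) ^ k * ∑ d ∈ smoothSet x Y w k cond, remSum A x w d ≤
        δ / 4 * X * Lx ^ (k - 1) := by
    intro cond _
    have hLxne : Lx ≠ 0 := hLx0.ne'
    have hmult := sum_remSum_le A (k := k) hk1 hx0.le hY0 hlevel cond
    have hM : ((k * (Nat.log 2 ⌊L⌋₊ + 1) ^ (k - 1) : ℕ) : ℝ) ≤ k * (3 * Lx) ^ (k - 1) := by
      push_cast
      refine mul_le_mul_of_nonneg_left (pow_le_pow_left₀ (by positivity) ?_ _) (Nat.cast_nonneg _)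
      have h := natlog_floor_le hL1 hLx'
      have hl2 : Lx / Real.log 2 ≤ 2 * Lx := by
        calc Lx / Real.log 2 ≤ Lx / (1 / 2) := div_le_div_of_nonneg_left hLx0.le (by norm_num)
              (by have := Real.log_two_gt_d9; linarith)
          _ = 2 * Lx := by ring
      linarith
    have hpowk : (1 + Lx) ^ k ≤ (2 * Lx) ^ k := pow_le_pow_left₀ (by linarith) h1Lx k
    have hsum0 : 0 ≤ ∑ d ∈ smoothSet x Y w k cond, remSum A x w d :=
      Finset.sum_nonneg fun d _ => remSum_nonneg A x w d
    have e1 : Lx ^ (2 * k + 1) = Lx ^ k * Lx ^ (k - 1) * Lx ^ 2 := by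
      rw [← pow_add, ← pow_add]; congr 1; omega
    have e3 : Lx ^ (k + 1) = Lx ^ (k - 1) * Lx ^ 2 := by rw [← pow_add]; congr 1; omega
    calc (2 : ℝ) ^ k * (1 + Lx) ^ k * ∑ d ∈ smoothSet x Y w k cond, remSum A x w d
        ≤ (2 : ℝ) ^ k * (2 * Lx) ^ k * ((k * (3 * Lx) ^ (k - 1)) * (CA2' * X / Lx ^ (2 * k + 1))) :=
          mul_le_mul (mul_le_mul_of_nonneg_left hpowk (by positivity))
            (hmult.trans (mul_le_mul hM hRA2 (Finset.sum_nonneg fun _ _ => abs_nonneg _)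
              (by positivity))) hsum0 (by positivity)
      _ = CR * X * (Lx ^ k * Lx ^ (k - 1)) / Lx ^ (2 * k + 1) := by
          rw [hCR, mul_pow, mul_pow]; ring
      _ = CR * X / Lx ^ 2 := by rw [e1]; field_simp
      _ ≤ (δ / 4 * Lx ^ (k + 1)) * X / Lx ^ 2 := by gcongr
      _ = δ / 4 * X * Lx ^ (k - 1) := by rw [e3]; field_simp
  -------------------------------------------------
  -- Bin G: the main term, by cases on `z ≤ w`
  -------------------------------------------------
  have hCfin0 : 0 ≤ Cfin := by rw [hCfin]; positivity
  have hCfin_ge : ∀ {M : ℝ}, 0 ≤ M → M ≤ (Cz + Call) * (2 : ℝ) ^ k →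
      K₁ * (C₇' / (θ * Lx)) * M / θ ≤ Cfin / Lx := by
    intro M hM0 hM
    have hLxne : Lx ≠ 0 := hLx0.ne'
    have hθne : θ ≠ 0 := hθ0.ne'
    have hnum : K₁ * C₇' * M ≤ K₁ * C₇' * (Cz + Call) * (2 : ℝ) ^ k := by
      calc K₁ * C₇' * M ≤ K₁ * C₇' * ((Cz + Call) * (2 : ℝ) ^ k) :=
            mul_le_mul_of_nonneg_left hM (mul_nonneg hK₁0 hC₇'0)
        _ = _ := by ring
    have hlhs : K₁ * (C₇' / (θ * Lx)) * M / θ = K₁ * C₇' * M / θ ^ 2 / Lx := by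
      field_simp
    rw [hlhs, hCfin]
    exact div_le_div_of_nonneg_right (div_le_div_of_nonneg_right hnum (sq_nonneg θ)) hLx0.le
  have hSG : ∑ n ∈ binG x z Y k, generalizedVonMangoldt k n * A.a n ≤
      Cfin * X * Lx ^ (k - 2) * Real.log z + δ / 4 * X * Lx ^ (k - 1) := by
    by_cases hzw : z ≤ w
    · -- variant (i): `cond d = (1 < d ∧ minFac d < z)`
      have hcond : ∀ n ∈ binG x z Y k, 1 < smoothPart w n ∧ ((smoothPart w n).minFac : ℝ) < z :=
        fun n hn => smoothPart_of_mem_binG_of_le hzw hn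
      have hG := binG_sum_le A hdim hg0 hx1' hX hw2 hwY hYk
        (fun d => 1 < d ∧ (d.minFac : ℝ) < z) hcond
      have hmainsum : ∑ d ∈ smoothSet x Y w k (fun d => 1 < d ∧ (d.minFac : ℝ) < z),
          weightW k x d * gsharp A d ≤ Cz * (1 + Lx) ^ (k - 1) * Real.log z := by
        refine le_trans (Finset.sum_le_sum_of_subset_of_nonneg (fun d hd => ?_)
          (fun d _ _ => mul_nonneg (weightW_nonneg k hx1' d) (gsharp_nonneg hg0 hg1 d)))
          (sum_weightW_gsharp_le_small A hg0 hg1 hCgz0 hCgz hxY1 hxYx hLx1 hz2)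
        obtain ⟨hdI, -, -, hc⟩ := Finset.mem_filter.mp hd
        exact Finset.mem_filter.mpr ⟨hdI, hc⟩
      have hmain : K₁ * X * A.densityProduct (primesProdBelow w) *
          ∑ d ∈ smoothSet x Y w k (fun d => 1 < d ∧ (d.minFac : ℝ) < z),
            weightW k x d * gsharp A d ≤ Cfin * X * Lx ^ (k - 2) * Real.log z := by
        have hpow : (1 + Lx) ^ (k - 1) ≤ (2 : ℝ) ^ (k - 1) * Lx ^ (k - 2) * Lx := by
          calc (1 + Lx) ^ (k - 1) ≤ (2 * Lx) ^ (k - 1) := pow_le_pow_left₀ (by linarith) h1Lx _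
            _ = (2 : ℝ) ^ (k - 1) * Lx ^ (k - 1) := mul_pow _ _ _
            _ = (2 : ℝ) ^ (k - 1) * Lx ^ (k - 2) * Lx := by
                rw [mul_assoc, ← pow_succ, show k - 2 + 1 = k - 1 by omega]
        have h2k : (2 : ℝ) ^ (k - 1) ≤ (2 : ℝ) ^ k := pow_le_pow_right₀ one_le_two (by omega)
        have hM : Cz * (2 : ℝ) ^ (k - 1) ≤ (Cz + Call) * (2 : ℝ) ^ k :=
          mul_le_mul (by linarith) h2k (by positivity) (by positivity)
        have hfin := hCfin_ge (by positivity : 0 ≤ Cz * (2 : ℝ) ^ (k - 1)) hM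
        have hsum0 : 0 ≤ ∑ d ∈ smoothSet x Y w k (fun d => 1 < d ∧ (d.minFac : ℝ) < z),
            weightW k x d * gsharp A d := Finset.sum_nonneg fun d _ =>
          mul_nonneg (weightW_nonneg k hx1' d) (gsharp_nonneg hg0 hg1 d)
        have hLxne : Lx ≠ 0 := hLx0.ne'
        have hθne : θ ≠ 0 := hθ0.ne'
        calc K₁ * X * A.densityProduct (primesProdBelow w) *
              ∑ d ∈ smoothSet x Y w k (fun d => 1 < d ∧ (d.minFac : ℝ) < z),
                weightW k x d * gsharp A d
            ≤ K₁ * X * (C₇' / (θ * Lx)) * (Cz * (1 + Lx) ^ (k - 1) * Real.log z) :=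
              mul_le_mul (mul_le_mul_of_nonneg_left hVw (mul_nonneg hK₁0 hX)) hmainsum hsum0
                (by positivity)
          _ ≤ K₁ * X * (C₇' / (θ * Lx)) * (Cz * ((2 : ℝ) ^ (k - 1) * Lx ^ (k - 2) * Lx) *
                Real.log z) := by gcongr
          _ = (K₁ * (C₇' / (θ * Lx)) * (Cz * (2 : ℝ) ^ (k - 1)) / θ) * (θ * Lx) *
                (X * Lx ^ (k - 2) * Real.log z) := by
              field_simp
          _ ≤ (Cfin / Lx) * (θ * Lx) * (X * Lx ^ (k - 2) * Real.log z) := by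
              gcongr
          _ = Cfin * θ * (X * Lx ^ (k - 2) * Real.log z) := by field_simp
          _ ≤ Cfin * 1 * (X * Lx ^ (k - 2) * Real.log z) :=
              mul_le_mul_of_nonneg_right (mul_le_mul_of_nonneg_left hθ1 hCfin0) (by positivity)
          _ = Cfin * X * Lx ^ (k - 2) * Real.log z := by ring
      calc _ ≤ _ := hG
        _ ≤ Cfin * X * Lx ^ (k - 2) * Real.log z + δ / 4 * X * Lx ^ (k - 1) := by
            rw [show (1 + 2 * K ^ (10 : ℕ)) * A.size x = K₁ * X by rw [hK₁]]
            exact add_le_add hmain (hREM _)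
    · -- variant (ii): `z > w`, so `log z > θ log x`; `cond = True`
      have hzw' : w < z := not_le.mp hzw
      have hlogzw : θ * Lx ≤ Real.log z := by
        rw [← hlogw]; exact Real.log_le_log (by linarith) hzw'.le
      have hG := binG_sum_le A hdim hg0 (z := z) hx1' hX hw2 hwY hYk (fun _ => True)
        (fun _ _ => trivial)
      have hmainsum : ∑ d ∈ smoothSet x Y w k (fun _ => True), weightW k x d * gsharp A d ≤
          Call * (1 + Lx) ^ k := by
        refine le_trans (Finset.sum_le_sum_of_subset_of_nonneg (fun d hd => ?_)
          (fun d _ _ => mul_nonneg (weightW_nonneg k hx1' d) (gsharp_nonneg hg0 hg1 d)))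
          (sum_weightW_gsharp_le_all A hg0 hg1 hCg0 hCg hxY1 hxYx)
        exact (Finset.mem_filter.mp hd).1
      have hmain : K₁ * X * A.densityProduct (primesProdBelow w) *
          ∑ d ∈ smoothSet x Y w k (fun _ => True), weightW k x d * gsharp A d ≤
            Cfin * X * Lx ^ (k - 2) * Real.log z := by
        have hpow : (1 + Lx) ^ k ≤ (2 : ℝ) ^ k * Lx ^ (k - 2) * Lx * Lx := by
          calc (1 + Lx) ^ k ≤ (2 * Lx) ^ k := pow_le_pow_left₀ (by linarith) h1Lx _
            _ = (2 : ℝ) ^ k * Lx ^ k := mul_pow _ _ _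
            _ = (2 : ℝ) ^ k * Lx ^ (k - 2) * Lx * Lx := by
                have : Lx ^ k = Lx ^ (k - 2) * Lx * Lx := by
                  rw [← pow_succ, ← pow_succ, show k - 2 + 1 + 1 = k by omega]
                rw [this]; ring
        have hM : Call * (2 : ℝ) ^ k ≤ (Cz + Call) * (2 : ℝ) ^ k :=
          mul_le_mul_of_nonneg_right (by linarith) (by positivity)
        have hfin := hCfin_ge (by positivity : 0 ≤ Call * (2 : ℝ) ^ k) hM
        have hsum0 : 0 ≤ ∑ d ∈ smoothSet x Y w k (fun _ => True), weightW k x d * gsharp A d :=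
          Finset.sum_nonneg fun d _ => mul_nonneg (weightW_nonneg k hx1' d) (gsharp_nonneg hg0 hg1 d)
        have hLxne : Lx ≠ 0 := hLx0.ne'
        have hθne : θ ≠ 0 := hθ0.ne'
        calc K₁ * X * A.densityProduct (primesProdBelow w) *
              ∑ d ∈ smoothSet x Y w k (fun _ => True), weightW k x d * gsharp A d
            ≤ K₁ * X * (C₇' / (θ * Lx)) * (Call * (1 + Lx) ^ k) :=
              mul_le_mul (mul_le_mul_of_nonneg_left hVw (mul_nonneg hK₁0 hX)) hmainsum hsum0
                (by positivity)
          _ ≤ K₁ * X * (C₇' / (θ * Lx)) * (Call * ((2 : ℝ) ^ k * Lx ^ (k - 2) * Lx * Lx)) := by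
              gcongr
          _ = (K₁ * (C₇' / (θ * Lx)) * (Call * (2 : ℝ) ^ k) / θ) * Lx *
                (X * Lx ^ (k - 2) * (θ * Lx)) := by
              field_simp
          _ ≤ (Cfin / Lx) * Lx * (X * Lx ^ (k - 2) * (θ * Lx)) := by gcongr
          _ = Cfin * (X * Lx ^ (k - 2) * (θ * Lx)) := by field_simp
          _ ≤ Cfin * (X * Lx ^ (k - 2) * Real.log z) :=
              mul_le_mul_of_nonneg_left (mul_le_mul_of_nonneg_left hlogzw (by positivity)) hCfin0
          _ = Cfin * X * Lx ^ (k - 2) * Real.log z := by ring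
      calc _ ≤ _ := hG
        _ ≤ Cfin * X * Lx ^ (k - 2) * Real.log z + δ / 4 * X * Lx ^ (k - 1) := by
            rw [show (1 + 2 * K ^ (10 : ℕ)) * A.size x = K₁ * X by rw [hK₁]]
            exact add_le_add hmain (hREM _)
  -------------------------------------------------
  -- Total
  -------------------------------------------------
  calc sigma0 A k x z ≤ _ := sigma0_le_bins A k x z Y
    _ ≤ δ / 4 * X * Lx ^ (k - 1) + δ / 4 * X * Lx ^ (k - 1) +
          (Cfin * X * Lx ^ (k - 2) * Real.log z + δ / 4 * X * Lx ^ (k - 1)) :=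
        add_le_add (add_le_add hSA hSS) hSG
    _ = Cfin * X * Lx ^ (k - 2) * Real.log z + (3 / 4 * δ) * X * Lx ^ (k - 1) := by ring
    _ ≤ Cfin * X * Lx ^ (k - 2) * Real.log z + δ * X * Lx ^ (k - 1) := by
        refine add_le_add le_rfl (mul_le_mul_of_nonneg_right
          (mul_le_mul_of_nonneg_right (by linarith) hX) (pow_nonneg hLx0.le _))

end SigmaZero

/-! ### Conclusion of the proof of Theorem 1 at a finite level (pp. 739–740) -/

/-- **The three lemmata combined at a finite level** ([FriedlanderIwaniecPisa1978] pp. 739–740,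
"Conclusion of proof of Theorem 1", up to the display
`∑_{n ≤ x} a_n Λ_{(k)}(n) = H A(x) F + O(ε^{1/3} A(x)(log x)^{|k|−1})` for `x > x₀(ε, (k))`), for a
sequence with `A(x) = ∑_{n ≤ x} a_n`, (A₁), (A₃), (A₄), (A₅), `A.HasDensityConstant H` and `g ≥ 0`.
With the running parameter `u = ε^{−1/3}` (`y = x^{1−2u^{−3}}`, `z = x^{u^{−4}}`, `s = u`): for
every `ε' > 0`, for all large `u`, for EVERY level exponent `θ₀ > 1 − u^{−3}`, (A₂) at level
`x^{θ₀}` (`SieveSequence.BombieriA2At`) gives, for all large `x`,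
`|S_k(x) − H A(x) F(x, y, z)| ≤ ε' A(x)(log x)^{k−1}`. Indeed (A₂) at level `x^{θ₀}` with
`ε₂ = θ₀ − (1 − u^{−3})` resp. `θ₀ − (1 − 1/(5k))` (positive, as `u ≥ 5k`) is exactly the (A₂)-input
of `FI1978_lemma11_finiteLevel`, `FI1978_lemma12_finiteLevel` (levels `x^{1−u^{−3}}`) resp.
`SigmaZero.sigma0_bound_finiteLevel` (level `x^{1−1/(5k)}`); the rest is the arithmetic of the
tree's `BombieriSieve.core` (`params`, `sigma0_arith`, `sigma2_arith` — where `k ≥ 2` enters —,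
`sigma1_arith` with (A₄) `∫₁^x A(t)dt/t = o(A(x) log x)` and `z^{−η} log x → 0`, and
`(C₁₀⁺ + 1 + 2C₁₂⁺)u^{−4} + C₁₁⁺ 2^{k+1} u^{−1} + C₁₂⁺ u⁸ e^{−u} → 0`). [cite:
FriedlanderIwaniecPisa1978, pp. 739-740 (conclusion of proof of Theorem 1)] -/
theorem core_finiteLevel (A : SieveSequence) (H : ℝ) (hsize : ∀ x, A.size x = A.congrSum 1 x)
    (h1 : A.BombieriA1) (h3 : A.BombieriA3) (h4 : A.BombieriA4) (h5 : A.BombieriA5)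
    (hH : A.HasDensityConstant H) (hg0 : ∀ d : ℕ, 1 ≤ d → 0 ≤ A.density d)
    {k : ℕ} (hk : 2 ≤ k) {ε : ℝ} (hε : 0 < ε) :
    ∀ᶠ u : ℝ in atTop, ∀ θ₀ : ℝ, 1 - u⁻¹ ^ 3 < θ₀ → A.BombieriA2At θ₀ → ∀ᶠ x : ℝ in atTop,
      |(∑ n ∈ Ioc 0 ⌊x⌋₊, generalizedVonMangoldt k n * A.a n) -
          H * A.size x * mainTermF k x (x ^ (1 - 2 * u⁻¹ ^ 3)) (x ^ (u⁻¹ ^ 4))| ≤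
        ε * A.size x * Real.log x ^ (k - 1) := by
  obtain ⟨m, rfl⟩ : ∃ m, k = m + 2 := ⟨k - 2, by omega⟩
  have e1 : m + 2 - 1 = m + 1 := by omega
  have e2 : m + 2 - 2 = m := by omega
  obtain ⟨C₀, hC₀⟩ := SigmaZero.sigma0_bound_finiteLevel A hsize h1 h3 h4 h5 hg0 hk
  obtain ⟨C₂, hC₂⟩ := FI1978_lemma11_finiteLevel A hsize h1 h5 hg0 (m + 2)
  obtain ⟨η, hη, C₁, hC₁⟩ := FI1978_lemma12_finiteLevel A H hsize h1 h5 hH hg0 m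
  simp only [e1, e2] at hC₀ ⊢
  set D₀ := max C₀ 0 with hD₀
  set D₁ := max C₁ 0 with hD₁
  set D₂ := max C₂ 0 with hD₂
  -- the function `Ψ(u)` bounding `|S − HAF| / (A L^{k−1})` tends to `0`
  have hΨ : Tendsto (fun u : ℝ => (D₀ + 1 + 2 * D₁) * u⁻¹ ^ 4 + D₂ * 2 ^ (m + 3) * u⁻¹ +
      D₁ * (u ^ 8 * Real.exp (-u))) atTop (𝓝 0) := by
    have h1 : Tendsto (fun u : ℝ => u⁻¹) atTop (𝓝 0) := tendsto_inv_atTop_zero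
    have h2 : Tendsto (fun u : ℝ => u⁻¹ ^ 4) atTop (𝓝 0) := by simpa using h1.pow 4
    have h3 := Real.tendsto_pow_mul_exp_neg_atTop_nhds_zero 8
    simpa using ((h2.const_mul (D₀ + 1 + 2 * D₁)).add (h1.const_mul (D₂ * 2 ^ (m + 3)))).add
      (h3.const_mul D₁)
  filter_upwards [(tendsto_order.1 hΨ).2 ε hε, eventually_ge_atTop (2 : ℝ),
    eventually_ge_atTop (5 * ((m + 2 : ℕ) : ℝ))] with u hu hu2 hu5 θ₀ hθ₀ h2θ
  -- from now on `u ≥ 2` is fixed; `v = u⁻¹ ≤ 1/2`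
  have hu0 : 0 < u := by linarith
  set v : ℝ := u⁻¹ with hv
  have hv0 : 0 < v := inv_pos.mpr hu0
  have hv1 : v ≤ 1 / 2 := by rw [hv, one_div]; exact (inv_le_inv₀ hu0 two_pos).mpr hu2
  have hvu : v * u = 1 := by rw [hv]; exact inv_mul_cancel₀ hu0.ne'
  -- the (A₂) inputs, at the levels `x^{1 − 1/(5k)}` and `x^{1 − v³}`
  have hk0 : (0 : ℝ) < 5 * ((m + 2 : ℕ) : ℝ) := by positivity
  have hv5 : v ≤ 1 / (5 * ((m + 2 : ℕ) : ℝ)) := by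
    rw [hv, one_div]; exact (inv_le_inv₀ hu0 hk0).mpr hu5
  have hv31 : v ^ 3 ≤ v := by
    calc v ^ 3 ≤ v ^ 1 := pow_le_pow_of_le_one hv0.le (by linarith) (by norm_num)
      _ = v := pow_one v
  have hlev1 : 0 < θ₀ - (1 - v ^ 3) := by linarith
  have hlev0 : 0 < θ₀ - (1 - 1 / (5 * ((m + 2 : ℕ) : ℝ))) := by linarith
  obtain ⟨Ca, hCa⟩ := h2θ _ hlev0 ((2 * (m + 2) + 1 : ℕ) : ℝ) (by positivity)
  obtain ⟨Cb, hCb⟩ := h2θ _ hlev1 ((3 : ℕ) : ℝ) (by positivity)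
  obtain ⟨Cc, hCc⟩ := h2θ _ hlev1 ((m + 3 : ℕ) : ℝ) (by positivity)
  rw [sub_sub_cancel] at hCa hCb hCc
  -- the three lemmata at this `u`
  have h10' := hC₀ (v ^ 4) (by positivity) Ca
  have h11' := hC₂ (v ^ 3) (by positivity) Cb
  have h12' := hC₁ (v ^ 3) (by positivity) u hu2 Cc
  -- (A₄): `∫₁^x A(t) dt/t ≤ v¹² A(x) log x` eventually
  have hI : ∀ᶠ x : ℝ in atTop,
      ∫ t in (1 : ℝ)..x, A.size t / t ≤ v ^ 12 * (A.size x * Real.log x) := by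
    filter_upwards [h4.1.bound (by positivity : 0 < v ^ 12),
      eventually_ge_atTop (1 : ℝ)] with x hx hx1
    have hA0 : 0 ≤ A.size x := SieveSequence.size_nonneg_of_size_eq hsize x
    rw [Real.norm_of_nonneg (mul_nonneg hA0 (Real.log_nonneg hx1))] at hx
    exact (le_abs_self _).trans hx
  -- `z^{−η} log x = x^{−η v⁴} log x ≤ v¹²` eventually
  have hzeta : ∀ᶠ x : ℝ in atTop, x ^ (-(η * v ^ 4)) * Real.log x ≤ v ^ 12 := by
    have hlo :=
      (isLittleO_log_rpow_rpow_atTop 1 (by positivity : 0 < η * v ^ 4)).tendsto_div_nhds_zero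
    filter_upwards [(tendsto_order.1 hlo).2 _ (by positivity : 0 < v ^ 12),
      eventually_gt_atTop (0 : ℝ)] with x hx hx0
    rw [Real.rpow_one] at hx
    rw [Real.rpow_neg hx0.le, inv_mul_eq_div]
    exact hx.le
  have hz2 : ∀ᶠ x : ℝ in atTop, 2 ≤ x ^ (v ^ 4) :=
    (tendsto_rpow_atTop (by positivity : 0 < v ^ 4)).eventually_ge_atTop 2
  filter_upwards [h10', h11', h12', hCa, hCb, hCc, hI, hzeta, hz2, eventually_ge_atTop (2 : ℝ)]
    with x h10x h11x h12x hCax hCbx hCcx hIx hzx hz2x hx2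
  -- notation and elementary facts at this `x`
  have hx0 : 0 < x := by linarith
  have hx1 : 1 < x := by linarith
  obtain ⟨hz14, hzy, hzsy, hyx, hy1, hzsy'⟩ := params hv0 hv1 hvu hx2
  set L := Real.log x with hL
  set S := A.size x with hS
  set y := x ^ (1 - 2 * v ^ 3) with hy
  set z := x ^ (v ^ 4) with hz
  have hL0 : 0 < L := Real.log_pos hx1
  have hS0 : 0 ≤ S := SieveSequence.size_nonneg_of_size_eq hsize x
  have hy0 : 0 < y := Real.rpow_pos_of_pos hx0 _
  have hlogz : Real.log z = v ^ 4 * L := Real.log_rpow hx0 _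
  have hlogxy : Real.log (x / y) = 2 * v ^ 3 * L := by
    rw [Real.log_div hx0.ne' hy0.ne', hy, Real.log_rpow hx0]; ring
  -- Lemma 10: Σ₀ ≤ (D₀ + 1) v⁴ · S L^{m+1}
  have B0 : sigma0 A (m + 2) x z ≤ (D₀ + 1) * v ^ 4 * (S * L ^ (m + 1)) := by
    have h := h10x hCax z hz2x hz14
    rw [hlogz] at h
    exact sigma0_arith hS0 hL0.le h
  -- Lemma 11: |Σ₂| ≤ D₂ 2^{m+3} v · S L^{m+1}
  have B2 : |sigma2 A (m + 2) x y z| ≤ D₂ * 2 ^ (m + 3) * v * (S * L ^ (m + 1)) := by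
    have h := h11x hCbx y z hz2x hzy hzsy hyx
    rw [hlogxy, hlogz] at h
    exact sigma2_arith hS0 hL0 hv0 (by linarith) h
  -- Lemma 12: |Σ₁ − HSF| ≤ D₁ (u⁸ e^{−u} + 2 v⁴) · S L^{m+1}
  have B1 : |sigma1 A (m + 2) x y z - H * S * mainTermF (m + 2) x y z| ≤
      D₁ * (u ^ 8 * Real.exp (-u) + 2 * v ^ 4) * (S * L ^ (m + 1)) := by
    have h := h12x hCcx y z hz2x hy1 hzsy'
    have hratio : L / Real.log z = u ^ 4 := by
      rw [hlogz, div_eq_iff (by positivity)]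
      have : v ^ 4 * u ^ 4 = 1 := by rw [← mul_pow, hvu, one_pow]
      calc L = L * (v ^ 4 * u ^ 4) := by rw [this, mul_one]
        _ = u ^ 4 * (v ^ 4 * L) := by ring
    have hzη : z ^ (-η) = x ^ (-(η * v ^ 4)) := by
      rw [hz, ← Real.rpow_mul hx0.le]; ring_nf
    rw [hratio, hzη] at h
    have hint0 : 0 ≤ ∫ t in (1 : ℝ)..x, A.size t / t :=
      intervalIntegral.integral_nonneg hx1.le fun t ht =>
        div_nonneg (SieveSequence.size_nonneg_of_size_eq hsize t) (by linarith [ht.1])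
    exact sigma1_arith hS0 hL0.le (Real.exp_pos _).le hint0 (Real.rpow_nonneg hx0.le _) hvu hIx
      hzx h
  -- combine
  have hsplit := sum_eq_sigma0_add_sigma1_add_sigma2 A (by omega : 0 < m + 2) x y z
  have h0abs : |sigma0 A (m + 2) x z| = sigma0 A (m + 2) x z :=
    abs_of_nonneg (sigma0_nonneg A _ x z)
  have hW0 : 0 ≤ S * L ^ (m + 1) := by positivity
  calc |(∑ n ∈ Ioc 0 ⌊x⌋₊, generalizedVonMangoldt (m + 2) n * A.a n) -
          H * S * mainTermF (m + 2) x y z|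
      = |sigma0 A (m + 2) x z + (sigma1 A (m + 2) x y z - H * S * mainTermF (m + 2) x y z) +
          sigma2 A (m + 2) x y z| := by rw [hsplit]; ring_nf
    _ ≤ |sigma0 A (m + 2) x z| + |sigma1 A (m + 2) x y z - H * S * mainTermF (m + 2) x y z| +
          |sigma2 A (m + 2) x y z| := abs_add_three _ _ _
    _ ≤ (D₀ + 1) * v ^ 4 * (S * L ^ (m + 1)) +
          D₁ * (u ^ 8 * Real.exp (-u) + 2 * v ^ 4) * (S * L ^ (m + 1)) +
          D₂ * 2 ^ (m + 3) * v * (S * L ^ (m + 1)) := by rw [h0abs]; linarith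
    _ = ((D₀ + 1 + 2 * D₁) * v ^ 4 + D₂ * 2 ^ (m + 3) * v + D₁ * (u ^ 8 * Real.exp (-u))) *
          (S * L ^ (m + 1)) := by ring
    _ ≤ ε * (S * L ^ (m + 1)) := mul_le_mul_of_nonneg_right hu.le hW0
    _ = ε * S * L ^ (m + 1) := by ring

end BombieriSieve

/-- **Bombieri's asymptotic sieve at a finite level, DISCHARGED** — the named fact
`Bombieri1976_asymptotic_sieve_finiteLevel` of `BombieriAsymptoticSieve.lean`
([FriedlanderIwaniecPisa1978] §4, conclusion of the proof of Theorem 1, pp. 739–740): if `(a_n)`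
satisfies (A₁), (A₃), (A₄), (A₅) with `A(x) = ∑_{n ≤ x} a_n` and `H = ∏_p (1 − 1/f(p))(1 − 1/p)⁻¹`
(`A.HasDensityConstant H`), then for every `k ≥ 2` and every `ε' > 0` there is `θ₀ < 1` such that
(A₂) at level `x^{θ₀}` alone gives
`|∑_{n ≤ x} a_n Λ_k(n) − k H A(x)(log x)^{k−1}| ≤ ε' k H A(x)(log x)^{k−1}` for all large `x`. Proof
(p. 740, "Since the sequence `a_n ≡ 1` satisfies the axioms, the above result holds also for it and
with the same `F`. Combining this with Lemma 3, `F = γ_{(k)}(log x)^{|k|−1} (1 + O(ε^{1/3}))` and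
hence the result follows"): if `g ≥ 0`, take `u` large for both `core_finiteLevel` (for `𝒜`,
accuracy `ε' k H/2`) and the tree's `BombieriSieve.core` for `SieveSequence.integers` (accuracy
`ε' k/4`; its lemma-facts `FI1978_lemma10_holds`, `FI1978_lemma11_holds`, `FI1978_lemma12_holds` are
theorems), offer `θ₀ = 1 − u^{−3}/2`, and conclude by Lemma 3 (`FI1978_lemma3_rat_holds`), `H > 0`
(Lemma 7, `FI1978_lemma7_of_A1_A5`) and `BombieriSieve.comparison_arith`, exactly as in
`Bombieri1976_asymptotic_sieve_of_lemmas`; if `g(d) < 0` for some `d ≥ 1`, offer `θ₀ = 1/2`: by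
`density_nonneg_or_size_eq_zero_of_bombieriA2At`, (A₂) at that level forces `A ≡ 0`, so `a_n = 0`
for all `n ≥ 1` and both sides vanish. [cite: FriedlanderIwaniecPisa1978, pp. 739-740 (conclusion of
proof of Theorem 1)] -/
theorem Bombieri1976_asymptotic_sieve_finiteLevel_holds :
    Bombieri1976_asymptotic_sieve_finiteLevel := by
  intro A H hsize h1 h3 h4 h5 hH k hk ε' hε'
  by_cases hg0 : ∀ d : ℕ, 1 ≤ d → 0 ≤ A.density d
  swap
  · -- degenerate case: a negative density value forces `A ≡ 0` under (A₂) at any level `θ₀ > 0`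
    refine ⟨1 / 2, by norm_num, fun h2θ => ?_⟩
    have hzero : ∀ x, A.size x = 0 :=
      (BombieriSieve.density_nonneg_or_size_eq_zero_of_bombieriA2At A hsize
        (by norm_num : (0 : ℝ) < 1 / 2) h2θ).resolve_left hg0
    refine Filter.Eventually.of_forall fun x => ?_
    have ha : ∀ n ∈ Ioc 0 ⌊x⌋₊, A.a n = 0 := by
      have hsum : ∑ n ∈ Ioc 0 ⌊x⌋₊, A.a n = 0 := by
        have h := hsize x
        rw [hzero x, SieveSequence.congrSum] at h
        rw [Finset.filter_true_of_mem (fun n _ => one_dvd n)] at h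
        exact h.symm
      exact (Finset.sum_eq_zero_iff_of_nonneg fun n _ => A.a_nonneg n).mp hsum
    have h0 : ∑ n ∈ Ioc 0 ⌊x⌋₊, generalizedVonMangoldt k n * A.a n = 0 :=
      Finset.sum_eq_zero fun n hn => by rw [ha n hn, mul_zero]
    rw [h0, hzero x]
    simp
  -- main case: `g ≥ 0`
  obtain ⟨m, rfl⟩ : ∃ m, k = m + 2 := ⟨k - 2, by omega⟩
  have e1 : m + 2 - 1 = m + 1 := by omega
  have e2 : m + 2 - 2 = m := by omega
  obtain ⟨H', hH'0, hH', -⟩ := BombieriSieve.FI1978_lemma7_of_A1_A5 A h1 h5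
  have hHH' : H = H' := tendsto_nhds_unique hH hH'
  have hH0 : 0 < H := hHH' ▸ hH'0
  obtain ⟨c₃, hc₃, h3'⟩ := FI1978_lemma3_rat_holds
  have hc₃0 : 0 < c₃ := by linarith
  simp only [e1]
  set κ : ℝ := ((m + 2 : ℕ) : ℝ) with hκ
  have hκ0 : 0 < κ := by rw [hκ]; positivity
  -- the two applications of `core` at a common `u`
  have hcoreA := BombieriSieve.core_finiteLevel A H hsize h1 h3 h4 h5 hH hg0 hk
    (ε := ε' * κ * H / 2) (by positivity)
  have hcore1 := BombieriSieve.core FI1978_lemma10_holds FI1978_lemma11_holds FI1978_lemma12_holds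
    SieveSequence.integers_isBombieriSequence SieveSequence.hasDensityConstant_integers hk
    (ε := ε' * κ / 4) (by positivity)
  obtain ⟨u, ⟨huA, hu1⟩, hu0⟩ := ((hcoreA.and hcore1).and (eventually_gt_atTop (0 : ℝ))).exists
  simp only [e1] at huA hu1
  have hv3 : 0 < u⁻¹ ^ 3 := by positivity
  refine ⟨1 - u⁻¹ ^ 3 / 2, by linarith, fun h2θ => ?_⟩
  have hxA' := huA (1 - u⁻¹ ^ 3 / 2) (by linarith) h2θ
  set ε₃ : ℝ := ε' * κ / 12 with hε₃
  have hε₃0 : 0 < ε₃ := by positivity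
  filter_upwards [hxA', hu1, eventually_ge_atTop c₃, eventually_ge_atTop (3 : ℝ),
    Real.tendsto_log_atTop.eventually_ge_atTop (c₃ ^ (m + 2) * 2 ^ m / ε₃),
    eventually_ge_atTop (2 * κ / ε₃)] with x hxA hx1 hxc₃ hx3 hxL hxfl
  have hx2 : 2 ≤ x := by linarith
  have hx0 : 0 < x := by linarith
  have hxone : 1 < x := by linarith
  set L := Real.log x with hL
  set S := A.size x with hS
  set N : ℝ := (⌊x⌋₊ : ℝ) with hN
  set F := BombieriSieve.mainTermF (m + 2) x (x ^ (1 - 2 * u⁻¹ ^ 3)) (x ^ (u⁻¹ ^ 4)) with hF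
  have hL1 : 1 ≤ L :=
    LFunctions.MertensBound.one_lt_log_three.le.trans (Real.log_le_log (by norm_num) hx3)
  have hL0 : 0 < L := by linarith
  have hS0 : 0 ≤ S := SieveSequence.size_nonneg_of_size_eq hsize x
  have hNx : x / 2 ≤ N := BombieriSieve.half_le_floor hx2
  have hN0 : 0 < N := by linarith
  have hNle : N ≤ x := Nat.floor_le hx0.le
  have hxN1 : x - N ≤ 1 := by have := Nat.lt_floor_add_one x; rw [hN]; linarith
  have hx2N : x ≤ 2 * N := by linarith
  have hκN : κ ≤ ε₃ * N := by
    rw [div_le_iff₀ hε₃0] at hxfl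
    calc κ = (2 * κ) / 2 := by ring
      _ ≤ x * ε₃ / 2 := by gcongr
      _ = ε₃ * (x / 2) := by ring
      _ ≤ ε₃ * N := mul_le_mul_of_nonneg_left hNx hε₃0.le
  -- the integers: `S_𝟙(x) = ∑ Λ_k(n)` and `|S_𝟙 − N F| ≤ (cκ/4) N L^{m+1}`
  have hsum1 : ∑ n ∈ Ioc 0 ⌊x⌋₊, generalizedVonMangoldt (m + 2) n * SieveSequence.integers.a n =
      ∑ n ∈ Ioc 0 ⌊x⌋₊, generalizedVonMangoldt (m + 2) n :=
    Finset.sum_congr rfl fun n _ => by rw [SieveSequence.integers_a, mul_one]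
  rw [hsum1, SieveSequence.integers_size, one_mul] at hx1
  -- Lemma 3: `|∑ Λ_k(n) − κ x L^{m+1}| ≤ c₃^{m+2} x (log c₃x)^m ≤ ε₃ x L^{m+1}`
  have h3x := h3' (m + 2) hk x hxone.le
  simp only [e1, e2] at h3x
  have hE : c₃ ^ (m + 2) * x * Real.log (c₃ * x) ^ m ≤ ε₃ * x * L ^ (m + 1) := by
    have hlogcx : Real.log (c₃ * x) ≤ 2 * L := by
      rw [Real.log_mul hc₃0.ne' hx0.ne']
      linarith [Real.log_le_log hc₃0 hxc₃]
    have hlogcx0 : 0 ≤ Real.log (c₃ * x) := Real.log_nonneg (by nlinarith)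
    calc c₃ ^ (m + 2) * x * Real.log (c₃ * x) ^ m ≤ c₃ ^ (m + 2) * x * (2 * L) ^ m := by gcongr
      _ = (c₃ ^ (m + 2) * 2 ^ m) * x * L ^ m := by ring
      _ ≤ (ε₃ * L) * x * L ^ m := by
          have hle : c₃ ^ (m + 2) * 2 ^ m ≤ ε₃ * L := by
            rw [div_le_iff₀ hε₃0] at hxL; linarith
          gcongr
      _ = ε₃ * x * L ^ (m + 1) := by ring
  have h3xx : |(∑ n ∈ Ioc 0 ⌊x⌋₊, generalizedVonMangoldt (m + 2) n) - κ * x * L ^ (m + 1)| ≤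
      ε' * κ / 12 * x * L ^ (m + 1) := h3x.trans hE
  -- conclusion
  exact BombieriSieve.comparison_arith hH0 hS0 hN0 (by positivity) hκ0.le hε'.le hNle hxN1 hx2N
    hκN hxA hx1 h3xx

end Literature.NumberTheory.Sieve
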